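import Literature.MathematicalPhysics.QuantumFieldTheory.Balaban1983to89.B6Block112CompositesV1
import Literature.MathematicalPhysics.QuantumFieldTheory.Balaban1983to89.B6BlockHolderCompositesV1
import Literature.MathematicalPhysics.QuantumFieldTheory.Balaban1983to89.B6HjOneLevelBridgeV1

/-!
# `Balaban1983to89.B6Block113CompositesV1` — T. Bałaban, *Propagators and renormalization transformations for lattice gauge theories. II*,
# Commun. Math. Phys. **96** (1984) 223–250 [Balaban1984PropagatorsII], Prop. 2.5 p. 246, towards the member (1.113)
# `‖ζ∇G∇*J‖_α ≤ O(1)e^{−δ₂|y−y′|}(‖ζ‖_α + |ζ|)(‖J‖_{α+ε} + |J|)` for the two-scale `G` of (2.90): the twice-differentiated summands `∇_μK₁∇_λ*`,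
# `(∇_μH_j)Q_j(G^{(n^{d+1})}∇_λ*)`, `(∇_μH_j)C̃^{(j)}_Λ(∇_λH_j)*` of `∇_μ(2.129)∇_λ*` have exponentially decaying PAIR (Hölder-in-the-output) block kernels
# for `tsV1` at the paper's scaling — file M5 of the (1.112)/(1.113) members (p38 gen 22), the pair-bound twin of file M2 `…B6Block112CompositesV1`

statement-level skeleton of published theorems with citation tags; proofs where landed; nothing here is a claim about the Yang–Mills mass gap

PDF held: `paper:balaban1984-cmp96-propagators-rt-ii` (journal page = PDF page + 222), p. 246 [PDF 24].  PRINT.  p. 246 (Prop. 2.5): *"The operator G_□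
defined by (2.90) … has the representation (2.129) and satisfies all the inequalities (1.110)–(1.114) of the Proposition 1.2 with a positive constant
δ₂ instead of δ₀."*; p. 246: *"The operators H′_j … their local Hölder norms are uniformly bounded"*, (2.130)–(2.131) for `H_j`, `G̃_j`; [4] (1.113)
p. 36: *"‖ζ∇G∇*J‖_α ≤ O(1)e^{−δ₀|y−y′|}(‖ζ‖_α + |ζ|)(‖J‖_{α+ε} + |J|) (1.113) for 0 ≤ α < 1, ε > 0, α + ε < 1, ζ ∈ C₀^∞(Δ̃(y)), supp J ⊂ Δ̃(y′)"*.

CITATION HEADER (lean-in-tree rule) — WHAT IS REPRODUCED.  Phase-2 file of the `lit-balaban` typed skeleton (HOME `run/shared/lean/pub/lit-balaban/`),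
seat **p38 gen 22** (B6 fold owner r03, referee ref-4), FILE M5 of the (1.112)/(1.113) members of p22's Prop. 2.5 two-level decay programme for the
genuine two-scale `G` of (2.90) (`…B6SectCTwoScaleV1Lattice.tsV1`, `Λ′` arbitrary, `c = L^j`); SKELETON rows **B6.Prop2.5** / **B6.Eq2.129–2.131**
(cells only; decls of record untouched).  WHAT THIS FILE DOES.  A PAIR BOUND of an operator `f` (fine bonds ← sources `k` at unit positions) at the
fine pair `b₁ = ⟨x, ν⟩`, `b₂ = ⟨x′, ν⟩` anchored at `y(x)` is `Σ_{k ∈ y}|f(e_k)_{b₁} − f(e_k)_{b₂}| ≤ C_f·e^{−δ|y(x) − y|_T}` (gen 21 file H1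
`…B6BlockHolderCalculus`); a pair bound of the FIRST factor composed with block bounds of the remaining factors is a pair bound of the product
(`holderBound_comp`).  With `∇_μ = n(S_μ − I)` on the left and `∇_λ* = n(S_λ⁻¹ − I)` on the right, at `c = L^j`, for `|x − x′|_∞ ≤ n`,
`t = |x − x′|_∞/n`, three of the six composite summands of `∇_μG∇_λ*` (file M3 `…B6Prop25Eq112TwoScaleV1.DGDadj_apply_eq`):
* `∇_μK₁∇_λ* = (∇_μ∂H′_j)·[C^{(j)}_Λ(∇_λ∂H′_j)*]` — pair bound `(C·t, δ)` (**`holderBound_DK1Dadj_scaling`**; first factor LIPSCHITZ, gen 21 file H2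
  `holderBound_DgradHp`; tail p22's `cov_entry_uniform` and `blockBound_DgradHp_adjoint`; the operator identity of file M2 §1);
* `(∇_μH_j)·[Q_jG^{(n^{d+1})}∇_λ*]` — pair bound `(C_α·t^α, δ(1−α))` (**`holderBound_DHjQGEDadj_scaling`**; first factor gen 21 file H3a `holderBound_DHj`,
  rate `κ_H(1−α)/(1+α)`; tail p22's `blockBound_Qv`, `blockBound_GEDadj_scaling` = [4] (1.110)₃ BY NAME);
* `(∇_μH_j)·[C̃^{(j)}_Λ(∇_λH_j)*]` — pair bound `(C_α·t^α, δ(1−α))` (**`holderBound_DHjCtDHjadj_scaling`**; tail p22's `blockBound_Ct_scaling`,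
  `blockBound_DHj_adjoint`; the operator identity of file M2 §3).
v1.1 (§§4–5): the `α`-FREE-RATE twins **`holderBound_DHjQGEDadj_rateFree`**, **`holderBound_DHjCtDHjadj_rateFree`** — the same proofs with r03's
`…B6HjOneLevelBridgeV1.holderBound_DHj_rateFree` ([BIJ85] (7.2.2) for `∇H_j` through the kernel bridge (2.130); rate depending on `d, L` only) for gen 21
file H3a's `holderBound_DHj`: pair bounds `(C_α·t^α, δ)`, ONE `δ` before `∀ α` (the printed quantifier shape; GAPS G-B6-p38-01 upgrade path (a)).
The other three composite summands (`(∇_μM)K₂∇_λ*`, `(∇_μK₂*)M∇_λ*`, `(∇_μK₂*)MK₂∇_λ*`) are first factors of gen 21 file H4a times tails of p22's files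
5–14 and are composed in file M6.  IMPORTS BY NAME, restating nothing.  THEOREMS ONLY (no `def`, no `def … : Prop`); standard axioms.  HONEST SCOPE /
DIVERGENCES. (1) one `λ`, one `μ`, differences with the factor `L^j` (p22 files 8/12). (2) The `α`-dependence of the decay RATE of the two `H_j`-led
summands is b05's HONEST LIMIT (i) propagated through gen 21 file H3a (the print claims `δ₂ = δ₂(d, L)`; r03's `B6HjOneLevelBridgeV1` is to supply the
`α`-free rate). (3) No new definition, no new hypothesis.  NOT summit progress.  Unit `lit-balaban-p38` (gen 22), 2026-08-22.
-/

noncomputable section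

open scoped InnerProductSpace BigOperators
open Finset

namespace Literature.MathematicalPhysics.QuantumFieldTheory.Balaban1983to89.B6Block113CompositesV1

open LatticeFieldCalculus B5SectBStatements B5Eq117TorusCarriers B6SectADomainsV1 B6SectAOperatorsV1 B6SectAVectorModelV1 B6SectCOperators
  B6SectCTwoScaleV1 B6SectCTwoScaleV1Lattice B5Eq118OneStroke
open BalabanImbrieJaffe1984to88.BIJ85AxialPropagator411 (BondSpace)
open B4Sect5Torus (IsPseudoDist SumBound)
open B4TorusKernel (periodConst)
open B4TorusKernel.MultiPeriod (torusSupNorm torusSupNorm_nonneg)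
open B4Sect5Proof (latticeConst latticeConst_nonneg)
open B5Hk163Decay (MG163 MG163_nonneg)
open B5Hk163Strip (kappaN kappaN_pos kappa163 kappa163_pos)
open B5Hk163TorusHolderDecay (CHD CdecD CdecD_nonneg)
open B5Kernel166Decay (periodConst_pos)
open B6LowerBound2153Torus (rep)
open B6Hprime2132Holder (MGHD)
open B6Repr2129Operator (K1_eq)
open B6BlockDecayCalculus (blockBound_comp torusDist_isPseudoDist torusDist_sumBound)
open B6BlockDecayHprimeCovV1 (MGHD_nonneg blockBound_C_of_entry cov_entry_uniform)
open B6BlockDecayGtV1 (blockBound_Qv)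
open B6BlockDecayGradFactorsV1 (blockBound_Ct_scaling)
open B6BlockDecayGDivBridgeV1 (adjoint_Dop blockBound_GEDadj_scaling)
open B6BlockDecayGDivFactorsV1 (blockBound_DgradHp_adjoint blockBound_DHj_adjoint)
open B6BlockHolderCalculus (holderBound_comp)
open B6BlockHolderLipschitzV1 (holderBound_DgradHp)
open B6BlockHolderHjV1 (holderBound_DHj CHD_nonneg)
open B6HjOneLevelBridgeV1 (holderBound_DHj_rateFree)

variable {d L m K : ℕ} {hd : 1 ≤ d + 1} {hL : Odd L ∧ 1 < L} {j : ℕ}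

/-! ## §1  `∇_μK₁∇_λ* = (∇_μ∂H′_j)C^{(j)}_Λ(∇_λ∂H′_j)*`: a LIPSCHITZ pair bound -/
set_option maxHeartbeats 400000 in
open Classical in
/-- **`∇_μK₁∇_λ* = (∇_μ∂H′_j)C^{(j)}_Λ(∇_λ∂H′_j)*` HAS AN EXPONENTIALLY DECAYING PAIR KERNEL, UNIFORMLY** (at `c = L^j`): `δ > 0`, `C ≥ 0` depending on `d, L`
only, such that at every fine pair `b₁ = ⟨x, ν⟩`, `b₂ = ⟨x′, ν⟩` with `|x − x′|_∞ ≤ n`, `Σ_{b₀′ ∈ y}|(∇_μK₁∇_λ*)(e_{b₀′})_{b₁} − (∇_μK₁∇_λ*)(e_{b₀′})_{b₂}| ≤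
C·(|x − x′|_∞/n)·e^{−δ|y(x) − y|_T}` — first factor `∇_μ∂H′_j` `((d+1)A₃e^{κ}·t, κ)` (gen 21 file H2), tail `C^{(j)}_Λ(∇_λ∂H′_j)*` `(E/n^{d+1}·A₂n^{d+1}(d+1)·K, δ₁)`
(p22), operator identity `(∂H′_j)*∇_λ* = (∇_λ∂H′_j)*` (p22's `adjoint_Dop`, file M2 §1). [cite: Balaban1984PropagatorsII, Prop. 2.5 p.246, p.246 (text after (2.132)); Balaban1984PropagatorsI, (1.113) p.36] -/
theorem holderBound_DK1Dadj_scaling (d L : ℕ) (hd : 1 ≤ d + 1) (hL : Odd L ∧ 1 < L) :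
    ∃ δ : ℝ, 0 < δ ∧ ∃ C : ℝ, 0 ≤ C ∧ ∀ (m K : ℕ) (j : ℕ) (hc : ((L : ℝ) ^ j) ≠ 0)
      (_hj : j + 1 ≤ (⟨d + 1, L, m, K, hd, hL⟩ : Params).m + (⟨d + 1, L, m, K, hd, hL⟩ : Params).K)
      (Λ' : Finset (Site (⟨d + 1, L, m, K, hd, hL⟩ : Params) (j + 1))) (w : CIdx j Λ' → ℝ) (_hw : ∀ i, 0 < w i) (lam mu : Fin (d + 1))
      (b₁ b₂ : PBond (⟨d + 1, L, m, K, hd, hL⟩ : Params) 0) (_hdir : b₁.dir = b₂.dir) (_hle : supDist b₁.src b₂.src ≤ L ^ j) (y : Site (⟨d + 1, L, m, K, hd, hL⟩ : Params) j),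
      ∑ b₀' ∈ univ.filter (fun b₀' : PBond (⟨d + 1, L, m, K, hd, hL⟩ : Params) 0 => iterBlockOf j b₀'.src = y),
          |(((((L : ℝ) ^ j) • (onE (LinearMap.funLeft ℝ ℝ (fun b : PBond (⟨d + 1, L, m, K, hd, hL⟩ : Params) 0 => (⟨b.src.shift mu, b.dir⟩ : PBond (⟨d + 1, L, m, K, hd, hL⟩ : Params) 0))) - LinearMap.id) : BondSpace (⟨d + 1, L, m, K, hd, hL⟩ : Params) →ₗ[ℝ] BondSpace (⟨d + 1, L, m, K, hd, hL⟩ : Params))) ∘ₗ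
            ((tsV1 hc Λ' w).K1 ∘ₗ ((((L : ℝ) ^ j) • (onE (LinearMap.funLeft ℝ ℝ (fun b : PBond (⟨d + 1, L, m, K, hd, hL⟩ : Params) 0 => (⟨b.src.unshift lam, b.dir⟩ : PBond (⟨d + 1, L, m, K, hd, hL⟩ : Params) 0))) - LinearMap.id) : BondSpace (⟨d + 1, L, m, K, hd, hL⟩ : Params) →ₗ[ℝ] BondSpace (⟨d + 1, L, m, K, hd, hL⟩ : Params))))) (EuclideanSpace.single b₀' (1 : ℝ)) b₁ -
           (((((L : ℝ) ^ j) • (onE (LinearMap.funLeft ℝ ℝ (fun b : PBond (⟨d + 1, L, m, K, hd, hL⟩ : Params) 0 => (⟨b.src.shift mu, b.dir⟩ : PBond (⟨d + 1, L, m, K, hd, hL⟩ : Params) 0))) - LinearMap.id) : BondSpace (⟨d + 1, L, m, K, hd, hL⟩ : Params) →ₗ[ℝ] BondSpace (⟨d + 1, L, m, K, hd, hL⟩ : Params))) ∘ₗ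
            ((tsV1 hc Λ' w).K1 ∘ₗ ((((L : ℝ) ^ j) • (onE (LinearMap.funLeft ℝ ℝ (fun b : PBond (⟨d + 1, L, m, K, hd, hL⟩ : Params) 0 => (⟨b.src.unshift lam, b.dir⟩ : PBond (⟨d + 1, L, m, K, hd, hL⟩ : Params) 0))) - LinearMap.id) : BondSpace (⟨d + 1, L, m, K, hd, hL⟩ : Params) →ₗ[ℝ] BondSpace (⟨d + 1, L, m, K, hd, hL⟩ : Params))))) (EuclideanSpace.single b₀' (1 : ℝ)) b₂| ≤
        C * (((supDist b₁.src b₂.src : ℕ) : ℝ) / (L : ℝ) ^ j) * Real.exp (-(δ * torusSupNorm (Mk (⟨d + 1, L, m, K, hd, hL⟩ : Params) j) (rep (Mk (⟨d + 1, L, m, K, hd, hL⟩ : Params) j) (iterBlockOf j b₁.src) - rep (Mk (⟨d + 1, L, m, K, hd, hL⟩ : Params) j) y))) := by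
  obtain ⟨δC, hδC, E, hE, hCov⟩ := cov_entry_uniform d L hd hL
  set κH : ℝ := kappaN (d + 1) / ((d : ℝ) + 1) with hκH
  have hκH0 : 0 < κH := div_pos (kappaN_pos _) (by positivity)
  set δ₁ : ℝ := min (δC / 2) κH with hδ₁
  set δ₂ : ℝ := min (δC / 2) (κH / 2) with hδ₂
  have hδ₁0 : 0 < δ₁ := lt_min (half_pos hδC) hκH0
  have hδ₂0 : 0 < δ₂ := lt_min (half_pos hδC) (half_pos hκH0)
  have hδ₁C : δ₁ < δC := lt_of_le_of_lt (min_le_left _ _) (half_lt_self hδC)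
  have hδ₁H : δ₁ ≤ κH := min_le_right _ _
  have hδ₂₁ : δ₂ ≤ δ₁ := le_min (min_le_left _ _) ((min_le_right _ _).trans (half_le_self hκH0.le))
  have hδ₂H : δ₂ < κH := lt_of_le_of_lt (min_le_right _ _) (half_lt_self hκH0)
  set K₁ : ℝ := latticeConst (d + 1) (δC - δ₁) with hK₁
  set K₂ : ℝ := latticeConst (d + 1) (κH - δ₂) with hK₂
  have hK₁0 : 0 ≤ K₁ := latticeConst_nonneg _ (by linarith)
  have hK₂0 : 0 ≤ K₂ := latticeConst_nonneg _ (by linarith)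
  have hL0 : 0 < L := by have := hL.2; omega
  haveI : NeZero L := ⟨by omega⟩
  have hLp : (0 : ℝ) < L := by exact_mod_cast hL0
  set Af : ℝ := ((d + 1 : ℕ) : ℝ) * (MGHD (d + 1) 3 * periodConst (kappaN (d + 1)) d) * Real.exp κH with hAf
  have hAf0 : 0 ≤ Af := by
    have := MGHD_nonneg (d + 1) 3
    have := periodConst_pos (kappaN_pos (d + 1)) d
    positivity
  set A₂ : ℝ := MGHD (d + 1) 2 * periodConst (kappaN (d + 1)) d with hA₂
  have hA₂0 : 0 ≤ A₂ := mul_nonneg (MGHD_nonneg _ _) (periodConst_pos (kappaN_pos _) _).le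
  set C : ℝ := Af * (E * (A₂ * ((d + 1 : ℕ) : ℝ)) * K₁) * K₂ with hC
  have hC0 : 0 ≤ C := by positivity
  refine ⟨δ₂, hδ₂0, C, hC0, ?_⟩
  intro m K j hc hj Λ' w hw lam mu b₁ b₂ hdir hle y
  have hj' : j ≤ m + K := Nat.le_of_succ_le hj
  set n : ℝ := ((L : ℝ) ^ j) ^ (d + 1) with hn
  have hn0 : 0 < n := by positivity
  have hLj : (0 : ℝ) < (L : ℝ) ^ j := by positivity
  have ht0 : 0 ≤ (((supDist b₁.src b₂.src : ℕ) : ℝ) / (L : ℝ) ^ j) := by positivity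
  have hρ : IsPseudoDist (fun t t' : Site (⟨d + 1, L, m, K, hd, hL⟩ : Params) j => torusSupNorm (Mk (⟨d + 1, L, m, K, hd, hL⟩ : Params) j) (rep (Mk (⟨d + 1, L, m, K, hd, hL⟩ : Params) j) t - rep (Mk (⟨d + 1, L, m, K, hd, hL⟩ : Params) j) t')) := torusDist_isPseudoDist (Mk (⟨d + 1, L, m, K, hd, hL⟩ : Params) j)
  have hK : SumBound (fun t t' : Site (⟨d + 1, L, m, K, hd, hL⟩ : Params) j => torusSupNorm (Mk (⟨d + 1, L, m, K, hd, hL⟩ : Params) j) (rep (Mk (⟨d + 1, L, m, K, hd, hL⟩ : Params) j) t - rep (Mk (⟨d + 1, L, m, K, hd, hL⟩ : Params) j) t')) (fun a => latticeConst (d + 1) a) := torusDist_sumBound (Mk (⟨d + 1, L, m, K, hd, hL⟩ : Params) j)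
  have h1 : |(L : ℝ) ^ j| / (L : ℝ) ^ j = 1 := by rw [abs_of_pos hLj, div_self hc]
  have hcast : (((L ^ j) ^ (d + 1) * (d + 1) : ℕ) : ℝ) = n * ((d + 1 : ℕ) : ℝ) := by rw [hn]; push_cast; ring
  have hθ : ((L : ℝ) ^ j / (L : ℝ) ^ j) ^ 4 * ((L : ℝ) ^ j) ^ (d + 1) = n := by rw [div_self hc, one_pow, one_mul]
  -- the first factor `∇_μ∂H′_j`: pair bound `(A_f·t, κ)` anchored at `y(x)` (gen 21 file H2)
  have hf : ∀ y' : Site (⟨d + 1, L, m, K, hd, hL⟩ : Params) j, ∑ y'' ∈ univ.filter (fun y'' : Site (⟨d + 1, L, m, K, hd, hL⟩ : Params) j => y'' = y'),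
      |(((((L : ℝ) ^ j) • (onE (LinearMap.funLeft ℝ ℝ (fun b : PBond (⟨d + 1, L, m, K, hd, hL⟩ : Params) 0 => (⟨b.src.shift mu, b.dir⟩ : PBond (⟨d + 1, L, m, K, hd, hL⟩ : Params) 0))) - LinearMap.id) : BondSpace (⟨d + 1, L, m, K, hd, hL⟩ : Params) →ₗ[ℝ] BondSpace (⟨d + 1, L, m, K, hd, hL⟩ : Params))) ∘ₗ ((tsV1 hc Λ' w).grad ∘ₗ (tsV1 hc Λ' w).hP)) (EuclideanSpace.single y'' (1 : ℝ)) b₁ -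
       (((((L : ℝ) ^ j) • (onE (LinearMap.funLeft ℝ ℝ (fun b : PBond (⟨d + 1, L, m, K, hd, hL⟩ : Params) 0 => (⟨b.src.shift mu, b.dir⟩ : PBond (⟨d + 1, L, m, K, hd, hL⟩ : Params) 0))) - LinearMap.id) : BondSpace (⟨d + 1, L, m, K, hd, hL⟩ : Params) →ₗ[ℝ] BondSpace (⟨d + 1, L, m, K, hd, hL⟩ : Params))) ∘ₗ ((tsV1 hc Λ' w).grad ∘ₗ (tsV1 hc Λ' w).hP)) (EuclideanSpace.single y'' (1 : ℝ)) b₂| ≤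
      Af * (((supDist b₁.src b₂.src : ℕ) : ℝ) / (L : ℝ) ^ j) * Real.exp (-(κH * torusSupNorm (Mk (⟨d + 1, L, m, K, hd, hL⟩ : Params) j) (rep (Mk (⟨d + 1, L, m, K, hd, hL⟩ : Params) j) (iterBlockOf j b₁.src) - rep (Mk (⟨d + 1, L, m, K, hd, hL⟩ : Params) j) y'))) := by
    intro y'
    refine (holderBound_DgradHp hc hj' Λ' w mu b₁ b₂ hdir hle y').trans (le_of_eq ?_)
    rw [h1, hAf, Nat.cast_one]; ring
  -- the tail factors (p22): `(∇_λ∂H′_j)*` `(A₂ n^{d+1}(d+1), κ)`, `C^{(j)}_Λ` `(E/n^{d+1}, δ_C)`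
  have hTs : ∀ (y' y : Site (⟨d + 1, L, m, K, hd, hL⟩ : Params) j),
      ∑ b₀ ∈ univ.filter (fun b₀ : PBond (⟨d + 1, L, m, K, hd, hL⟩ : Params) 0 => iterBlockOf j b₀.src = y),
          |LinearMap.adjoint (((((L : ℝ) ^ j) • (onE (LinearMap.funLeft ℝ ℝ (fun b : PBond (⟨d + 1, L, m, K, hd, hL⟩ : Params) 0 => (⟨b.src.shift lam, b.dir⟩ : PBond (⟨d + 1, L, m, K, hd, hL⟩ : Params) 0))) - LinearMap.id) : BondSpace (⟨d + 1, L, m, K, hd, hL⟩ : Params) →ₗ[ℝ] BondSpace (⟨d + 1, L, m, K, hd, hL⟩ : Params))) ∘ₗ ((tsV1 hc Λ' w).grad ∘ₗ (tsV1 hc Λ' w).hP)) (EuclideanSpace.single b₀ (1 : ℝ)) y'| ≤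
        A₂ * (n * ((d + 1 : ℕ) : ℝ)) * Real.exp (-(κH * torusSupNorm (Mk (⟨d + 1, L, m, K, hd, hL⟩ : Params) j) (rep (Mk (⟨d + 1, L, m, K, hd, hL⟩ : Params) j) y' - rep (Mk (⟨d + 1, L, m, K, hd, hL⟩ : Params) j) y))) := by
    intro y' y
    refine (blockBound_DgradHp_adjoint hc Λ' w hj' lam y' y).trans (le_of_eq ?_)
    rw [h1, hcast]; ring
  have hCb : ∀ (x y : Site (⟨d + 1, L, m, K, hd, hL⟩ : Params) j),
      ∑ x' ∈ univ.filter (fun x' : Site (⟨d + 1, L, m, K, hd, hL⟩ : Params) j => x' = y), |(tsV1 hc Λ' w).C (EuclideanSpace.single x' (1 : ℝ)) x| ≤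
        E / n * Real.exp (-(δC * torusSupNorm (Mk (⟨d + 1, L, m, K, hd, hL⟩ : Params) j) (rep (Mk (⟨d + 1, L, m, K, hd, hL⟩ : Params) j) x - rep (Mk (⟨d + 1, L, m, K, hd, hL⟩ : Params) j) y))) := by
    intro x y
    refine (blockBound_C_of_entry hc Λ' w (E := E / n) (δ := δC) (by positivity) (fun x x' => ?_) x y).trans (le_of_eq ?_)
    · have h := hCov m K ((L : ℝ) ^ j) hc j hj Λ' w hw x x'
      rwa [hθ] at h
    · rw [Nat.cast_one, mul_one]
  -- the tail `C^{(j)}_Λ(∇_λ∂H′_j)*`: block bound `(E/n^{d+1}·A₂n^{d+1}(d+1)·K₁, δ₁)`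
  have hg : ∀ (x y : Site (⟨d + 1, L, m, K, hd, hL⟩ : Params) j), ∑ b₀ ∈ univ.filter (fun b₀ : PBond (⟨d + 1, L, m, K, hd, hL⟩ : Params) 0 => iterBlockOf j b₀.src = y),
      |((tsV1 hc Λ' w).C ∘ₗ LinearMap.adjoint (((((L : ℝ) ^ j) • (onE (LinearMap.funLeft ℝ ℝ (fun b : PBond (⟨d + 1, L, m, K, hd, hL⟩ : Params) 0 => (⟨b.src.shift lam, b.dir⟩ : PBond (⟨d + 1, L, m, K, hd, hL⟩ : Params) 0))) - LinearMap.id) : BondSpace (⟨d + 1, L, m, K, hd, hL⟩ : Params) →ₗ[ℝ] BondSpace (⟨d + 1, L, m, K, hd, hL⟩ : Params))) ∘ₗ ((tsV1 hc Λ' w).grad ∘ₗ (tsV1 hc Λ' w).hP))) (EuclideanSpace.single b₀ (1 : ℝ)) x| ≤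
      E / n * (A₂ * (n * ((d + 1 : ℕ) : ℝ))) * K₁ * Real.exp (-(δ₁ * torusSupNorm (Mk (⟨d + 1, L, m, K, hd, hL⟩ : Params) j) (rep (Mk (⟨d + 1, L, m, K, hd, hL⟩ : Params) j) x - rep (Mk (⟨d + 1, L, m, K, hd, hL⟩ : Params) j) y))) := by
    intro x y
    have h := blockBound_comp hρ hK (tsV1 hc Λ' w).C (LinearMap.adjoint (((((L : ℝ) ^ j) • (onE (LinearMap.funLeft ℝ ℝ (fun b : PBond (⟨d + 1, L, m, K, hd, hL⟩ : Params) 0 => (⟨b.src.shift lam, b.dir⟩ : PBond (⟨d + 1, L, m, K, hd, hL⟩ : Params) 0))) - LinearMap.id) : BondSpace (⟨d + 1, L, m, K, hd, hL⟩ : Params) →ₗ[ℝ] BondSpace (⟨d + 1, L, m, K, hd, hL⟩ : Params))) ∘ₗ ((tsV1 hc Λ' w).grad ∘ₗ (tsV1 hc Λ' w).hP)))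
      (fun x : Site (⟨d + 1, L, m, K, hd, hL⟩ : Params) j => x) (fun x : Site (⟨d + 1, L, m, K, hd, hL⟩ : Params) j => x) (fun b₀ : PBond (⟨d + 1, L, m, K, hd, hL⟩ : Params) 0 => iterBlockOf j b₀.src)
      (by positivity : 0 ≤ E / n) (by positivity : 0 ≤ A₂ * (n * ((d + 1 : ℕ) : ℝ))) hδ₁0.le hδ₁H hδ₁C hCb hTs x y
    rw [hK₁]; exact h
  -- `∇_μK₁∇_λ* = (∇_μ∂H′_j) ∘ C ∘ (∇_λ∂H′_j)*` as operators (file M2 §1)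
  have hadj : LinearMap.adjoint ((tsV1 hc Λ' w).grad ∘ₗ (tsV1 hc Λ' w).hP) ∘ₗ ((((L : ℝ) ^ j) • (onE (LinearMap.funLeft ℝ ℝ (fun b : PBond (⟨d + 1, L, m, K, hd, hL⟩ : Params) 0 => (⟨b.src.unshift lam, b.dir⟩ : PBond (⟨d + 1, L, m, K, hd, hL⟩ : Params) 0))) - LinearMap.id) : BondSpace (⟨d + 1, L, m, K, hd, hL⟩ : Params) →ₗ[ℝ] BondSpace (⟨d + 1, L, m, K, hd, hL⟩ : Params))) =
      LinearMap.adjoint (((((L : ℝ) ^ j) • (onE (LinearMap.funLeft ℝ ℝ (fun b : PBond (⟨d + 1, L, m, K, hd, hL⟩ : Params) 0 => (⟨b.src.shift lam, b.dir⟩ : PBond (⟨d + 1, L, m, K, hd, hL⟩ : Params) 0))) - LinearMap.id) : BondSpace (⟨d + 1, L, m, K, hd, hL⟩ : Params) →ₗ[ℝ] BondSpace (⟨d + 1, L, m, K, hd, hL⟩ : Params))) ∘ₗ ((tsV1 hc Λ' w).grad ∘ₗ (tsV1 hc Λ' w).hP)) := by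
    rw [LinearMap.adjoint_comp ((((L : ℝ) ^ j) • (onE (LinearMap.funLeft ℝ ℝ (fun b : PBond (⟨d + 1, L, m, K, hd, hL⟩ : Params) 0 => (⟨b.src.shift lam, b.dir⟩ : PBond (⟨d + 1, L, m, K, hd, hL⟩ : Params) 0))) - LinearMap.id) : BondSpace (⟨d + 1, L, m, K, hd, hL⟩ : Params) →ₗ[ℝ] BondSpace (⟨d + 1, L, m, K, hd, hL⟩ : Params))) ((tsV1 hc Λ' w).grad ∘ₗ (tsV1 hc Λ' w).hP), adjoint_Dop]
  have hop : (((((L : ℝ) ^ j) • (onE (LinearMap.funLeft ℝ ℝ (fun b : PBond (⟨d + 1, L, m, K, hd, hL⟩ : Params) 0 => (⟨b.src.shift mu, b.dir⟩ : PBond (⟨d + 1, L, m, K, hd, hL⟩ : Params) 0))) - LinearMap.id) : BondSpace (⟨d + 1, L, m, K, hd, hL⟩ : Params) →ₗ[ℝ] BondSpace (⟨d + 1, L, m, K, hd, hL⟩ : Params))) ∘ₗ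
            ((tsV1 hc Λ' w).K1 ∘ₗ ((((L : ℝ) ^ j) • (onE (LinearMap.funLeft ℝ ℝ (fun b : PBond (⟨d + 1, L, m, K, hd, hL⟩ : Params) 0 => (⟨b.src.unshift lam, b.dir⟩ : PBond (⟨d + 1, L, m, K, hd, hL⟩ : Params) 0))) - LinearMap.id) : BondSpace (⟨d + 1, L, m, K, hd, hL⟩ : Params) →ₗ[ℝ] BondSpace (⟨d + 1, L, m, K, hd, hL⟩ : Params))))) =
      (((((L : ℝ) ^ j) • (onE (LinearMap.funLeft ℝ ℝ (fun b : PBond (⟨d + 1, L, m, K, hd, hL⟩ : Params) 0 => (⟨b.src.shift mu, b.dir⟩ : PBond (⟨d + 1, L, m, K, hd, hL⟩ : Params) 0))) - LinearMap.id) : BondSpace (⟨d + 1, L, m, K, hd, hL⟩ : Params) →ₗ[ℝ] BondSpace (⟨d + 1, L, m, K, hd, hL⟩ : Params))) ∘ₗ ((tsV1 hc Λ' w).grad ∘ₗ (tsV1 hc Λ' w).hP)) ∘ₗ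
        (tsV1 hc Λ' w).C ∘ₗ
          LinearMap.adjoint (((((L : ℝ) ^ j) • (onE (LinearMap.funLeft ℝ ℝ (fun b : PBond (⟨d + 1, L, m, K, hd, hL⟩ : Params) 0 => (⟨b.src.shift lam, b.dir⟩ : PBond (⟨d + 1, L, m, K, hd, hL⟩ : Params) 0))) - LinearMap.id) : BondSpace (⟨d + 1, L, m, K, hd, hL⟩ : Params) →ₗ[ℝ] BondSpace (⟨d + 1, L, m, K, hd, hL⟩ : Params))) ∘ₗ ((tsV1 hc Λ' w).grad ∘ₗ (tsV1 hc Λ' w).hP)) := by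
    rw [K1_eq (isLattice Λ' hc hj hw), ← hadj]
    refine LinearMap.ext fun v => ?_
    simp only [LinearMap.comp_apply]
  rw [hop]
  have h := holderBound_comp hρ hK (((((L : ℝ) ^ j) • (onE (LinearMap.funLeft ℝ ℝ (fun b : PBond (⟨d + 1, L, m, K, hd, hL⟩ : Params) 0 => (⟨b.src.shift mu, b.dir⟩ : PBond (⟨d + 1, L, m, K, hd, hL⟩ : Params) 0))) - LinearMap.id) : BondSpace (⟨d + 1, L, m, K, hd, hL⟩ : Params) →ₗ[ℝ] BondSpace (⟨d + 1, L, m, K, hd, hL⟩ : Params))) ∘ₗ ((tsV1 hc Λ' w).grad ∘ₗ (tsV1 hc Λ' w).hP))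
    ((tsV1 hc Λ' w).C ∘ₗ LinearMap.adjoint (((((L : ℝ) ^ j) • (onE (LinearMap.funLeft ℝ ℝ (fun b : PBond (⟨d + 1, L, m, K, hd, hL⟩ : Params) 0 => (⟨b.src.shift lam, b.dir⟩ : PBond (⟨d + 1, L, m, K, hd, hL⟩ : Params) 0))) - LinearMap.id) : BondSpace (⟨d + 1, L, m, K, hd, hL⟩ : Params) →ₗ[ℝ] BondSpace (⟨d + 1, L, m, K, hd, hL⟩ : Params))) ∘ₗ ((tsV1 hc Λ' w).grad ∘ₗ (tsV1 hc Λ' w).hP)))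
    (fun x : Site (⟨d + 1, L, m, K, hd, hL⟩ : Params) j => x) (fun b₀ : PBond (⟨d + 1, L, m, K, hd, hL⟩ : Params) 0 => iterBlockOf j b₀.src) b₁ b₂ (iterBlockOf j b₁.src)
    (by positivity : 0 ≤ Af * (((supDist b₁.src b₂.src : ℕ) : ℝ) / (L : ℝ) ^ j)) (by positivity : 0 ≤ E / n * (A₂ * (n * ((d + 1 : ℕ) : ℝ))) * K₁)
    hδ₂0.le hδ₂₁ hδ₂H hf hg y
  refine h.trans (le_of_eq ?_)
  rw [hC, hK₁, hK₂]
  field_simp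

/-! ## §2  `(∇_μH_j)Q_j(G^{(n^{d+1})}∇_λ*)`: an `α`-HÖLDER pair bound -/

open Classical in
/-- **`(∇_μH_j)Q_j(G^{(n^{d+1})}∇_λ*)` HAS AN EXPONENTIALLY DECAYING PAIR KERNEL** (at `c = L^j`; the `H_j`-part of `∇_μG̃_j∇_λ*`): there is `δ > 0` depending
on `d, L` only and for every `0 ≤ α < 1` a `C_α ≥ 0` with the pair bound `(C_α·t^α, δ(1−α))`, `t = |x − x′|_∞/n ≤ 1` — first factor `∇_μH_j` (gen 21
file H3a `holderBound_DHj`, rate `κ_H(1−α)/(1+α) > δ(1−α)`), tail `Q_j(G^{(n^{d+1})}∇_λ*)` (p22's `blockBound_Qv`, `blockBound_GEDadj_scaling` = [4] Prop. 1.2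
(1.110)₃ BY NAME, composed as in file M2 §2). [cite: Balaban1984PropagatorsII, (2.131) p.246, Prop. 2.5 p.246; Balaban1984PropagatorsI, (1.110) p.35, (1.113) p.36] -/
theorem holderBound_DHjQGEDadj_scaling (d L : ℕ) (hd : 1 ≤ d + 1) (hL : Odd L ∧ 1 < L) :
    ∃ δ : ℝ, 0 < δ ∧ ∀ α : ℝ, 0 ≤ α → α < 1 → ∃ C : ℝ, 0 ≤ C ∧ ∀ (m K : ℕ) (j : ℕ) (hc : ((L : ℝ) ^ j) ≠ 0)
      (hj : j + 1 ≤ (⟨d + 1, L, m, K, hd, hL⟩ : Params).m + (⟨d + 1, L, m, K, hd, hL⟩ : Params).K)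
      (Λ' : Finset (Site (⟨d + 1, L, m, K, hd, hL⟩ : Params) (j + 1))) (w : CIdx j Λ' → ℝ) (_hw : ∀ i, 0 < w i)
      (hw' : (0 : ℝ) < 1 * ((L : ℝ) ^ j) ^ (d + 1)) (lam mu : Fin (d + 1))
      (b₁ b₂ : PBond (⟨d + 1, L, m, K, hd, hL⟩ : Params) 0) (_hdir : b₁.dir = b₂.dir) (_hle : supDist b₁.src b₂.src ≤ L ^ j) (y : Site (⟨d + 1, L, m, K, hd, hL⟩ : Params) j),
      ∑ b₀' ∈ univ.filter (fun b₀' : PBond (⟨d + 1, L, m, K, hd, hL⟩ : Params) 0 => iterBlockOf j b₀'.src = y),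
          |((((((L : ℝ) ^ j) • (onE (LinearMap.funLeft ℝ ℝ (fun b : PBond (⟨d + 1, L, m, K, hd, hL⟩ : Params) 0 => (⟨b.src.shift mu, b.dir⟩ : PBond (⟨d + 1, L, m, K, hd, hL⟩ : Params) 0))) - LinearMap.id) : BondSpace (⟨d + 1, L, m, K, hd, hL⟩ : Params) →ₗ[ℝ] BondSpace (⟨d + 1, L, m, K, hd, hL⟩ : Params))) ∘ₗ (tsV1 hc Λ' w).Hj) ∘ₗ
            ((tsV1 hc Λ' w).Qv ∘ₗ (GE (Domains.whole (P := (⟨d + 1, L, m, K, hd, hL⟩ : Params)) j (Nat.le_of_succ_le hj)) hc (w := fun _ => 1 * ((L : ℝ) ^ j) ^ (d + 1)) (fun _ => hw') ∘ₗ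
              ((((L : ℝ) ^ j) • (onE (LinearMap.funLeft ℝ ℝ (fun b : PBond (⟨d + 1, L, m, K, hd, hL⟩ : Params) 0 => (⟨b.src.unshift lam, b.dir⟩ : PBond (⟨d + 1, L, m, K, hd, hL⟩ : Params) 0))) - LinearMap.id) : BondSpace (⟨d + 1, L, m, K, hd, hL⟩ : Params) →ₗ[ℝ] BondSpace (⟨d + 1, L, m, K, hd, hL⟩ : Params)))))) (EuclideanSpace.single b₀' (1 : ℝ)) b₁ -
           ((((((L : ℝ) ^ j) • (onE (LinearMap.funLeft ℝ ℝ (fun b : PBond (⟨d + 1, L, m, K, hd, hL⟩ : Params) 0 => (⟨b.src.shift mu, b.dir⟩ : PBond (⟨d + 1, L, m, K, hd, hL⟩ : Params) 0))) - LinearMap.id) : BondSpace (⟨d + 1, L, m, K, hd, hL⟩ : Params) →ₗ[ℝ] BondSpace (⟨d + 1, L, m, K, hd, hL⟩ : Params))) ∘ₗ (tsV1 hc Λ' w).Hj) ∘ₗ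
            ((tsV1 hc Λ' w).Qv ∘ₗ (GE (Domains.whole (P := (⟨d + 1, L, m, K, hd, hL⟩ : Params)) j (Nat.le_of_succ_le hj)) hc (w := fun _ => 1 * ((L : ℝ) ^ j) ^ (d + 1)) (fun _ => hw') ∘ₗ
              ((((L : ℝ) ^ j) • (onE (LinearMap.funLeft ℝ ℝ (fun b : PBond (⟨d + 1, L, m, K, hd, hL⟩ : Params) 0 => (⟨b.src.unshift lam, b.dir⟩ : PBond (⟨d + 1, L, m, K, hd, hL⟩ : Params) 0))) - LinearMap.id) : BondSpace (⟨d + 1, L, m, K, hd, hL⟩ : Params) →ₗ[ℝ] BondSpace (⟨d + 1, L, m, K, hd, hL⟩ : Params)))))) (EuclideanSpace.single b₀' (1 : ℝ)) b₂| ≤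
        C * (((supDist b₁.src b₂.src : ℕ) : ℝ) / (L : ℝ) ^ j) ^ α * Real.exp (-(δ * (1 - α) * torusSupNorm (Mk (⟨d + 1, L, m, K, hd, hL⟩ : Params) j) (rep (Mk (⟨d + 1, L, m, K, hd, hL⟩ : Params) j) (iterBlockOf j b₁.src) - rep (Mk (⟨d + 1, L, m, K, hd, hL⟩ : Params) j) y))) := by
  obtain ⟨δD, hδD, CD, hCD, hDG⟩ := blockBound_GEDadj_scaling d L hd hL one_pos
  set κH : ℝ := kappa163 (d + 1) / ((d : ℝ) + 1) with hκH
  have hκH0 : 0 < κH := div_pos (kappa163_pos _) (by positivity)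
  -- rates: the tail at `δ₁ = min(δ_D, κ_H/2)`; the product at `δ(1−α)`, `δ = min(δ₁, κ_H/4)`
  set δ₁ : ℝ := min δD (κH / 2) with hδ₁
  have hδ₁0 : 0 < δ₁ := lt_min hδD (half_pos hκH0)
  have hδ₁D : δ₁ ≤ δD := min_le_left _ _
  have hδ₁H : δ₁ < κH := lt_of_le_of_lt (min_le_right _ _) (half_lt_self hκH0)
  set δ : ℝ := min δ₁ (κH / 4) with hδ
  have hδ0 : 0 < δ := lt_min hδ₁0 (by linarith)
  have hδδ₁ : δ ≤ δ₁ := min_le_left _ _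
  have hδH : δ ≤ κH / 4 := min_le_right _ _
  set K₁ : ℝ := latticeConst (d + 1) (κH - δ₁) with hK₁
  have hK₁0 : 0 ≤ K₁ := latticeConst_nonneg _ (by linarith)
  have hL0 : 0 < L := by have := hL.2; omega
  haveI : NeZero L := ⟨by omega⟩
  have hLp : (0 : ℝ) < L := by exact_mod_cast hL0
  refine ⟨δ, hδ0, fun α hα0 hα1 => ?_⟩
  have h1α : 0 < 1 - α := by linarith
  have h1pα : 0 < 1 + α := by linarith
  have hpos : 0 < κH * (1 - α) := mul_pos hκH0 h1α
  have hδ'0 : 0 ≤ δ * (1 - α) := by positivity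
  have hδ'b : δ * (1 - α) ≤ δ₁ := (mul_le_of_le_one_right hδ0.le (by linarith)).trans hδδ₁
  have hδ'a : δ * (1 - α) < κH * ((1 - α) / (1 + α)) := by
    rw [← mul_div_assoc, lt_div_iff₀ h1pα]
    calc δ * (1 - α) * (1 + α) ≤ κH / 4 * (1 - α) * (1 + α) :=
          mul_le_mul_of_nonneg_right (mul_le_mul_of_nonneg_right hδH h1α.le) h1pα.le
      _ = κH * (1 - α) * ((1 + α) / 4) := by ring
      _ < κH * (1 - α) * 1 := mul_lt_mul_of_pos_left (by linarith) hpos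
      _ = κH * (1 - α) := mul_one _
  have hCHD : 0 ≤ CHD d α := CHD_nonneg (d := d) hα0 hα1
  set K₂ : ℝ := latticeConst (d + 1) (κH * ((1 - α) / (1 + α)) - δ * (1 - α)) with hK₂
  have hK₂0 : 0 ≤ K₂ := latticeConst_nonneg _ (by linarith)
  set AD : ℝ := CHD d α * ((d + 1 : ℕ) : ℝ) * Real.exp κH * ((1 * (d + 1) : ℕ) : ℝ) with hAD
  have hAD0 : 0 ≤ AD := by positivity
  set C : ℝ := AD * (Real.exp κH * CD * K₁) * K₂ with hC
  have hC0 : 0 ≤ C := by positivity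
  refine ⟨C, hC0, ?_⟩
  intro m K j hc hj Λ' w hw hw' lam mu b₁ b₂ hdir hle y
  have hj' : j ≤ m + K := Nat.le_of_succ_le hj
  have hLj : (0 : ℝ) < (L : ℝ) ^ j := by positivity
  have ht0 : 0 ≤ (((supDist b₁.src b₂.src : ℕ) : ℝ) / (L : ℝ) ^ j) ^ α := Real.rpow_nonneg (by positivity) _
  have hρ : IsPseudoDist (fun t t' : Site (⟨d + 1, L, m, K, hd, hL⟩ : Params) j => torusSupNorm (Mk (⟨d + 1, L, m, K, hd, hL⟩ : Params) j) (rep (Mk (⟨d + 1, L, m, K, hd, hL⟩ : Params) j) t - rep (Mk (⟨d + 1, L, m, K, hd, hL⟩ : Params) j) t')) := torusDist_isPseudoDist (Mk (⟨d + 1, L, m, K, hd, hL⟩ : Params) j)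
  have hK : SumBound (fun t t' : Site (⟨d + 1, L, m, K, hd, hL⟩ : Params) j => torusSupNorm (Mk (⟨d + 1, L, m, K, hd, hL⟩ : Params) j) (rep (Mk (⟨d + 1, L, m, K, hd, hL⟩ : Params) j) t - rep (Mk (⟨d + 1, L, m, K, hd, hL⟩ : Params) j) t')) (fun a => latticeConst (d + 1) a) := torusDist_sumBound (Mk (⟨d + 1, L, m, K, hd, hL⟩ : Params) j)
  -- the first factor `∇_μH_j`: pair bound `(CHD(d+1)e^{κ_H}t^α(d+1), κ_H(1−α)/(1+α))` (gen 21 file H3a)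
  have hf : ∀ y' : Site (⟨d + 1, L, m, K, hd, hL⟩ : Params) j, ∑ b ∈ univ.filter (fun b : PBond (⟨d + 1, L, m, K, hd, hL⟩ : Params) j => b.src = y'),
      |(((((L : ℝ) ^ j) • (onE (LinearMap.funLeft ℝ ℝ (fun b : PBond (⟨d + 1, L, m, K, hd, hL⟩ : Params) 0 => (⟨b.src.shift mu, b.dir⟩ : PBond (⟨d + 1, L, m, K, hd, hL⟩ : Params) 0))) - LinearMap.id) : BondSpace (⟨d + 1, L, m, K, hd, hL⟩ : Params) →ₗ[ℝ] BondSpace (⟨d + 1, L, m, K, hd, hL⟩ : Params))) ∘ₗ (tsV1 hc Λ' w).Hj) (EuclideanSpace.single b (1 : ℝ)) b₁ -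
       (((((L : ℝ) ^ j) • (onE (LinearMap.funLeft ℝ ℝ (fun b : PBond (⟨d + 1, L, m, K, hd, hL⟩ : Params) 0 => (⟨b.src.shift mu, b.dir⟩ : PBond (⟨d + 1, L, m, K, hd, hL⟩ : Params) 0))) - LinearMap.id) : BondSpace (⟨d + 1, L, m, K, hd, hL⟩ : Params) →ₗ[ℝ] BondSpace (⟨d + 1, L, m, K, hd, hL⟩ : Params))) ∘ₗ (tsV1 hc Λ' w).Hj) (EuclideanSpace.single b (1 : ℝ)) b₂| ≤
      CHD d α * ((d + 1 : ℕ) : ℝ) * Real.exp κH * (((supDist b₁.src b₂.src : ℕ) : ℝ) / (L : ℝ) ^ j) ^ α * ((1 * (d + 1) : ℕ) : ℝ) *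
        Real.exp (-(κH * ((1 - α) / (1 + α)) * torusSupNorm (Mk (⟨d + 1, L, m, K, hd, hL⟩ : Params) j) (rep (Mk (⟨d + 1, L, m, K, hd, hL⟩ : Params) j) (iterBlockOf j b₁.src) - rep (Mk (⟨d + 1, L, m, K, hd, hL⟩ : Params) j) y'))) :=
    fun y' => holderBound_DHj hc hj Λ' hw hα0 hα1 mu b₁ b₂ hdir hle y'
  -- the tail `Q_j ∘ (G^{(n^{d+1})}∇_λ*)` at the rate `δ₁` (p22; composed as in file M2 §2)
  have hDGb := hDG m K j hj' hc hw' lam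
  have hQ := blockBound_Qv hc hj' Λ' w hκH0.le
  have hg' := blockBound_comp hρ hK (tsV1 hc Λ' w).Qv (GE (Domains.whole (P := (⟨d + 1, L, m, K, hd, hL⟩ : Params)) j hj') hc (w := fun _ => 1 * ((L : ℝ) ^ j) ^ (d + 1)) (fun _ => hw') ∘ₗ ((((L : ℝ) ^ j) • (onE (LinearMap.funLeft ℝ ℝ (fun b : PBond (⟨d + 1, L, m, K, hd, hL⟩ : Params) 0 => (⟨b.src.unshift lam, b.dir⟩ : PBond (⟨d + 1, L, m, K, hd, hL⟩ : Params) 0))) - LinearMap.id) : BondSpace (⟨d + 1, L, m, K, hd, hL⟩ : Params) →ₗ[ℝ] BondSpace (⟨d + 1, L, m, K, hd, hL⟩ : Params))))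
    (fun b : PBond (⟨d + 1, L, m, K, hd, hL⟩ : Params) j => b.src) (fun b₀ : PBond (⟨d + 1, L, m, K, hd, hL⟩ : Params) 0 => iterBlockOf j b₀.src) (fun b₀ : PBond (⟨d + 1, L, m, K, hd, hL⟩ : Params) 0 => iterBlockOf j b₀.src)
    (Cf := Real.exp κH) (Cg := CD) (by positivity) hCD hδ₁0.le hδ₁D hδ₁H hQ hDGb
  have hg : ∀ (b : PBond (⟨d + 1, L, m, K, hd, hL⟩ : Params) j) (y : Site (⟨d + 1, L, m, K, hd, hL⟩ : Params) j), ∑ b₀ ∈ univ.filter (fun b₀ : PBond (⟨d + 1, L, m, K, hd, hL⟩ : Params) 0 => iterBlockOf j b₀.src = y),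
      |((tsV1 hc Λ' w).Qv ∘ₗ (GE (Domains.whole (P := (⟨d + 1, L, m, K, hd, hL⟩ : Params)) j hj') hc (w := fun _ => 1 * ((L : ℝ) ^ j) ^ (d + 1)) (fun _ => hw') ∘ₗ ((((L : ℝ) ^ j) • (onE (LinearMap.funLeft ℝ ℝ (fun b : PBond (⟨d + 1, L, m, K, hd, hL⟩ : Params) 0 => (⟨b.src.unshift lam, b.dir⟩ : PBond (⟨d + 1, L, m, K, hd, hL⟩ : Params) 0))) - LinearMap.id) : BondSpace (⟨d + 1, L, m, K, hd, hL⟩ : Params) →ₗ[ℝ] BondSpace (⟨d + 1, L, m, K, hd, hL⟩ : Params))))) (EuclideanSpace.single b₀ (1 : ℝ)) b| ≤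
      Real.exp κH * CD * K₁ * Real.exp (-(δ₁ * torusSupNorm (Mk (⟨d + 1, L, m, K, hd, hL⟩ : Params) j) (rep (Mk (⟨d + 1, L, m, K, hd, hL⟩ : Params) j) b.src - rep (Mk (⟨d + 1, L, m, K, hd, hL⟩ : Params) j) y))) := by
    intro b y
    have h := hg' b y
    rw [hK₁]; exact h
  have h := holderBound_comp hρ hK (((((L : ℝ) ^ j) • (onE (LinearMap.funLeft ℝ ℝ (fun b : PBond (⟨d + 1, L, m, K, hd, hL⟩ : Params) 0 => (⟨b.src.shift mu, b.dir⟩ : PBond (⟨d + 1, L, m, K, hd, hL⟩ : Params) 0))) - LinearMap.id) : BondSpace (⟨d + 1, L, m, K, hd, hL⟩ : Params) →ₗ[ℝ] BondSpace (⟨d + 1, L, m, K, hd, hL⟩ : Params))) ∘ₗ (tsV1 hc Λ' w).Hj) ((tsV1 hc Λ' w).Qv ∘ₗ (GE (Domains.whole (P := (⟨d + 1, L, m, K, hd, hL⟩ : Params)) j hj') hc (w := fun _ => 1 * ((L : ℝ) ^ j) ^ (d + 1)) (fun _ => hw') ∘ₗ ((((L : ℝ) ^ j) • (onE (LinearMap.funLeft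 ℝ ℝ (fun b : PBond (⟨d + 1, L, m, K, hd, hL⟩ : Params) 0 => (⟨b.src.unshift lam, b.dir⟩ : PBond (⟨d + 1, L, m, K, hd, hL⟩ : Params) 0))) - LinearMap.id) : BondSpace (⟨d + 1, L, m, K, hd, hL⟩ : Params) →ₗ[ℝ] BondSpace (⟨d + 1, L, m, K, hd, hL⟩ : Params)))))
    (fun b : PBond (⟨d + 1, L, m, K, hd, hL⟩ : Params) j => b.src) (fun b₀ : PBond (⟨d + 1, L, m, K, hd, hL⟩ : Params) 0 => iterBlockOf j b₀.src) b₁ b₂ (iterBlockOf j b₁.src)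
    (by positivity : 0 ≤ CHD d α * ((d + 1 : ℕ) : ℝ) * Real.exp κH * (((supDist b₁.src b₂.src : ℕ) : ℝ) / (L : ℝ) ^ j) ^ α * ((1 * (d + 1) : ℕ) : ℝ))
    (by positivity : 0 ≤ Real.exp κH * CD * K₁)
    hδ'0 hδ'b hδ'a hf hg y
  refine h.trans (le_of_eq ?_)
  rw [hC, hAD, hK₁, hK₂]
  ring

/-! ## §3  `(∇_μH_j)C̃^{(j)}_Λ(∇_λH_j)*`: an `α`-HÖLDER pair bound -/

open Classical in
/-- **`∇_μ(H_jC̃^{(j)}_ΛH_j*)∇_λ* = (∇_μH_j)C̃^{(j)}_Λ(∇_λH_j)*` HAS AN EXPONENTIALLY DECAYING PAIR KERNEL** (at `c = L^j`, weights `a₀n^{d+1} ≤ w ≤ a₁n^{d+1}`):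
there is `δ > 0` (on `d, L, a₀, a₁`) and for every `0 ≤ α < 1` a `C_α ≥ 0` with the pair bound `(C_α·t^α, δ(1−α))` — first factor `∇_μH_j` (gen 21 file
H3a), tail `C̃^{(j)}_Λ(∇_λH_j)*` (p22's `blockBound_Ct_scaling`, `blockBound_DHj_adjoint`), operator identity `H_j*∇_λ* = (∇_λH_j)*` (p22's
`adjoint_Dop`, file M2 §3). [cite: Balaban1984PropagatorsII, Prop. 2.5 p.246, (2.130) p.246; Balaban1984PropagatorsI, (1.113) p.36, p.29 lines 1–2] -/
theorem holderBound_DHjCtDHjadj_scaling (d L : ℕ) (hd : 1 ≤ d + 1) (hL : Odd L ∧ 1 < L) {a₀ a₁ : ℝ} (ha₀ : 0 < a₀) (ha₁ : a₀ ≤ a₁) :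
    ∃ δ : ℝ, 0 < δ ∧ ∀ α : ℝ, 0 ≤ α → α < 1 → ∃ C : ℝ, 0 ≤ C ∧ ∀ (m K : ℕ) (j : ℕ) (hc : ((L : ℝ) ^ j) ≠ 0)
      (_hj : j + 1 ≤ (⟨d + 1, L, m, K, hd, hL⟩ : Params).m + (⟨d + 1, L, m, K, hd, hL⟩ : Params).K)
      (Λ' : Finset (Site (⟨d + 1, L, m, K, hd, hL⟩ : Params) (j + 1))) (w : CIdx j Λ' → ℝ)
      (_hw0 : ∀ i, a₀ * ((L : ℝ) ^ j) ^ (d + 1) ≤ w i) (_hw1 : ∀ i, w i ≤ a₁ * ((L : ℝ) ^ j) ^ (d + 1)) (lam mu : Fin (d + 1))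
      (b₁ b₂ : PBond (⟨d + 1, L, m, K, hd, hL⟩ : Params) 0) (_hdir : b₁.dir = b₂.dir) (_hle : supDist b₁.src b₂.src ≤ L ^ j) (y : Site (⟨d + 1, L, m, K, hd, hL⟩ : Params) j),
      ∑ b₀' ∈ univ.filter (fun b₀' : PBond (⟨d + 1, L, m, K, hd, hL⟩ : Params) 0 => iterBlockOf j b₀'.src = y),
          |(((((L : ℝ) ^ j) • (onE (LinearMap.funLeft ℝ ℝ (fun b : PBond (⟨d + 1, L, m, K, hd, hL⟩ : Params) 0 => (⟨b.src.shift mu, b.dir⟩ : PBond (⟨d + 1, L, m, K, hd, hL⟩ : Params) 0))) - LinearMap.id) : BondSpace (⟨d + 1, L, m, K, hd, hL⟩ : Params) →ₗ[ℝ] BondSpace (⟨d + 1, L, m, K, hd, hL⟩ : Params))) ∘ₗ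
            (((tsV1 hc Λ' w).Hj ∘ₗ (tsV1 hc Λ' w).Ct ∘ₗ LinearMap.adjoint (tsV1 hc Λ' w).Hj) ∘ₗ ((((L : ℝ) ^ j) • (onE (LinearMap.funLeft ℝ ℝ (fun b : PBond (⟨d + 1, L, m, K, hd, hL⟩ : Params) 0 => (⟨b.src.unshift lam, b.dir⟩ : PBond (⟨d + 1, L, m, K, hd, hL⟩ : Params) 0))) - LinearMap.id) : BondSpace (⟨d + 1, L, m, K, hd, hL⟩ : Params) →ₗ[ℝ] BondSpace (⟨d + 1, L, m, K, hd, hL⟩ : Params))))) (EuclideanSpace.single b₀' (1 : ℝ)) b₁ -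
           (((((L : ℝ) ^ j) • (onE (LinearMap.funLeft ℝ ℝ (fun b : PBond (⟨d + 1, L, m, K, hd, hL⟩ : Params) 0 => (⟨b.src.shift mu, b.dir⟩ : PBond (⟨d + 1, L, m, K, hd, hL⟩ : Params) 0))) - LinearMap.id) : BondSpace (⟨d + 1, L, m, K, hd, hL⟩ : Params) →ₗ[ℝ] BondSpace (⟨d + 1, L, m, K, hd, hL⟩ : Params))) ∘ₗ
            (((tsV1 hc Λ' w).Hj ∘ₗ (tsV1 hc Λ' w).Ct ∘ₗ LinearMap.adjoint (tsV1 hc Λ' w).Hj) ∘ₗ ((((L : ℝ) ^ j) • (onE (LinearMap.funLeft ℝ ℝ (fun b : PBond (⟨d + 1, L, m, K, hd, hL⟩ : Params) 0 => (⟨b.src.unshift lam, b.dir⟩ : PBond (⟨d + 1, L, m, K, hd, hL⟩ : Params) 0))) - LinearMap.id) : BondSpace (⟨d + 1, L, m, K, hd, hL⟩ : Params) →ₗ[ℝ] BondSpace (⟨d + 1, L, m, K, hd, hL⟩ : Params))))) (EuclideanSpace.single b₀' (1 : ℝ)) b₂| ≤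
        C * (((supDist b₁.src b₂.src : ℕ) : ℝ) / (L : ℝ) ^ j) ^ α * Real.exp (-(δ * (1 - α) * torusSupNorm (Mk (⟨d + 1, L, m, K, hd, hL⟩ : Params) j) (rep (Mk (⟨d + 1, L, m, K, hd, hL⟩ : Params) j) (iterBlockOf j b₁.src) - rep (Mk (⟨d + 1, L, m, K, hd, hL⟩ : Params) j) y))) := by
  obtain ⟨δC, hδC, E, hE, hCt⟩ := blockBound_Ct_scaling d L hd hL ha₀ ha₁
  set κH : ℝ := kappa163 (d + 1) / ((d : ℝ) + 1) with hκH
  have hκH0 : 0 < κH := div_pos (kappa163_pos _) (by positivity)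
  -- rates: the tail at `δ₁ = min(δ_C/2, κ_H)`; the product at `δ(1−α)`, `δ = min(δ_C/2, κ_H/4)`
  set δ₁ : ℝ := min (δC / 2) κH with hδ₁
  have hδ₁0 : 0 < δ₁ := lt_min (half_pos hδC) hκH0
  have hδ₁C : δ₁ < δC := lt_of_le_of_lt (min_le_left _ _) (half_lt_self hδC)
  have hδ₁H : δ₁ ≤ κH := min_le_right _ _
  set δ : ℝ := min (δC / 2) (κH / 4) with hδ
  have hδ0 : 0 < δ := lt_min (half_pos hδC) (by linarith)
  have hδδ₁ : δ ≤ δ₁ := le_min (min_le_left _ _) ((min_le_right _ _).trans (by linarith))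
  have hδH : δ ≤ κH / 4 := min_le_right _ _
  set K₁ : ℝ := latticeConst (d + 1) (δC - δ₁) with hK₁
  have hK₁0 : 0 ≤ K₁ := latticeConst_nonneg _ (by linarith)
  have hL0 : 0 < L := by have := hL.2; omega
  haveI : NeZero L := ⟨by omega⟩
  have hLp : (0 : ℝ) < L := by exact_mod_cast hL0
  set AH : ℝ := CdecD d with hAH
  have hAH0 : 0 ≤ AH := CdecD_nonneg (d := d)
  refine ⟨δ, hδ0, fun α hα0 hα1 => ?_⟩
  have h1α : 0 < 1 - α := by linarith
  have h1pα : 0 < 1 + α := by linarith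
  have hpos : 0 < κH * (1 - α) := mul_pos hκH0 h1α
  have hδ'0 : 0 ≤ δ * (1 - α) := by positivity
  have hδ'b : δ * (1 - α) ≤ δ₁ := (mul_le_of_le_one_right hδ0.le (by linarith)).trans hδδ₁
  have hδ'a : δ * (1 - α) < κH * ((1 - α) / (1 + α)) := by
    rw [← mul_div_assoc, lt_div_iff₀ h1pα]
    calc δ * (1 - α) * (1 + α) ≤ κH / 4 * (1 - α) * (1 + α) :=
          mul_le_mul_of_nonneg_right (mul_le_mul_of_nonneg_right hδH h1α.le) h1pα.le
      _ = κH * (1 - α) * ((1 + α) / 4) := by ring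
      _ < κH * (1 - α) * 1 := mul_lt_mul_of_pos_left (by linarith) hpos
      _ = κH * (1 - α) := mul_one _
  have hCHD : 0 ≤ CHD d α := CHD_nonneg (d := d) hα0 hα1
  set K₂ : ℝ := latticeConst (d + 1) (κH * ((1 - α) / (1 + α)) - δ * (1 - α)) with hK₂
  have hK₂0 : 0 ≤ K₂ := latticeConst_nonneg _ (by linarith)
  set AD : ℝ := CHD d α * ((d + 1 : ℕ) : ℝ) * Real.exp κH * ((1 * (d + 1) : ℕ) : ℝ) with hAD
  have hAD0 : 0 ≤ AD := by positivity
  set C : ℝ := AD * (E * (AH * ((d + 1 : ℕ) : ℝ)) * K₁) * K₂ with hC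
  have hC0 : 0 ≤ C := by positivity
  refine ⟨C, hC0, ?_⟩
  intro m K j hc hj Λ' w hw0 hw1 lam mu b₁ b₂ hdir hle y
  have hj' : j ≤ m + K := Nat.le_of_succ_le hj
  set n : ℝ := ((L : ℝ) ^ j) ^ (d + 1) with hn
  have hn0 : 0 < n := by positivity
  have hLj : (0 : ℝ) < (L : ℝ) ^ j := by positivity
  have hw : ∀ i, 0 < w i := fun i => lt_of_lt_of_le (by positivity) (hw0 i)
  have ht0 : 0 ≤ (((supDist b₁.src b₂.src : ℕ) : ℝ) / (L : ℝ) ^ j) ^ α := Real.rpow_nonneg (by positivity) _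
  have hρ : IsPseudoDist (fun t t' : Site (⟨d + 1, L, m, K, hd, hL⟩ : Params) j => torusSupNorm (Mk (⟨d + 1, L, m, K, hd, hL⟩ : Params) j) (rep (Mk (⟨d + 1, L, m, K, hd, hL⟩ : Params) j) t - rep (Mk (⟨d + 1, L, m, K, hd, hL⟩ : Params) j) t')) := torusDist_isPseudoDist (Mk (⟨d + 1, L, m, K, hd, hL⟩ : Params) j)
  have hK : SumBound (fun t t' : Site (⟨d + 1, L, m, K, hd, hL⟩ : Params) j => torusSupNorm (Mk (⟨d + 1, L, m, K, hd, hL⟩ : Params) j) (rep (Mk (⟨d + 1, L, m, K, hd, hL⟩ : Params) j) t - rep (Mk (⟨d + 1, L, m, K, hd, hL⟩ : Params) j) t')) (fun a => latticeConst (d + 1) a) := torusDist_sumBound (Mk (⟨d + 1, L, m, K, hd, hL⟩ : Params) j)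
  have hcast : (((L ^ j) ^ (d + 1) * (d + 1) : ℕ) : ℝ) = n * ((d + 1 : ℕ) : ℝ) := by rw [hn]; push_cast; ring
  -- the first factor `∇_μH_j` (gen 21 file H3a)
  have hf : ∀ y' : Site (⟨d + 1, L, m, K, hd, hL⟩ : Params) j, ∑ b ∈ univ.filter (fun b : PBond (⟨d + 1, L, m, K, hd, hL⟩ : Params) j => b.src = y'),
      |(((((L : ℝ) ^ j) • (onE (LinearMap.funLeft ℝ ℝ (fun b : PBond (⟨d + 1, L, m, K, hd, hL⟩ : Params) 0 => (⟨b.src.shift mu, b.dir⟩ : PBond (⟨d + 1, L, m, K, hd, hL⟩ : Params) 0))) - LinearMap.id) : BondSpace (⟨d + 1, L, m, K, hd, hL⟩ : Params) →ₗ[ℝ] BondSpace (⟨d + 1, L, m, K, hd, hL⟩ : Params))) ∘ₗ (tsV1 hc Λ' w).Hj) (EuclideanSpace.single b (1 : ℝ)) b₁ -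
       (((((L : ℝ) ^ j) • (onE (LinearMap.funLeft ℝ ℝ (fun b : PBond (⟨d + 1, L, m, K, hd, hL⟩ : Params) 0 => (⟨b.src.shift mu, b.dir⟩ : PBond (⟨d + 1, L, m, K, hd, hL⟩ : Params) 0))) - LinearMap.id) : BondSpace (⟨d + 1, L, m, K, hd, hL⟩ : Params) →ₗ[ℝ] BondSpace (⟨d + 1, L, m, K, hd, hL⟩ : Params))) ∘ₗ (tsV1 hc Λ' w).Hj) (EuclideanSpace.single b (1 : ℝ)) b₂| ≤
      CHD d α * ((d + 1 : ℕ) : ℝ) * Real.exp κH * (((supDist b₁.src b₂.src : ℕ) : ℝ) / (L : ℝ) ^ j) ^ α * ((1 * (d + 1) : ℕ) : ℝ) *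
        Real.exp (-(κH * ((1 - α) / (1 + α)) * torusSupNorm (Mk (⟨d + 1, L, m, K, hd, hL⟩ : Params) j) (rep (Mk (⟨d + 1, L, m, K, hd, hL⟩ : Params) j) (iterBlockOf j b₁.src) - rep (Mk (⟨d + 1, L, m, K, hd, hL⟩ : Params) j) y'))) :=
    fun y' => holderBound_DHj hc hj Λ' hw hα0 hα1 mu b₁ b₂ hdir hle y'
  -- the tail factors (p22): `(∇_λH_j)*` `(A_H n^{d+1}(d+1), κ_H)`, `C̃^{(j)}_Λ` `(E/n^{d+1}, δ_C)`
  have hTs : ∀ (b : PBond (⟨d + 1, L, m, K, hd, hL⟩ : Params) j) (y : Site (⟨d + 1, L, m, K, hd, hL⟩ : Params) j),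
      ∑ b₀ ∈ univ.filter (fun b₀ : PBond (⟨d + 1, L, m, K, hd, hL⟩ : Params) 0 => iterBlockOf j b₀.src = y),
          |LinearMap.adjoint (((((L : ℝ) ^ j) • (onE (LinearMap.funLeft ℝ ℝ (fun b : PBond (⟨d + 1, L, m, K, hd, hL⟩ : Params) 0 => (⟨b.src.shift lam, b.dir⟩ : PBond (⟨d + 1, L, m, K, hd, hL⟩ : Params) 0))) - LinearMap.id) : BondSpace (⟨d + 1, L, m, K, hd, hL⟩ : Params) →ₗ[ℝ] BondSpace (⟨d + 1, L, m, K, hd, hL⟩ : Params))) ∘ₗ (tsV1 hc Λ' w).Hj) (EuclideanSpace.single b₀ (1 : ℝ)) b| ≤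
        AH * (n * ((d + 1 : ℕ) : ℝ)) * Real.exp (-(κH * torusSupNorm (Mk (⟨d + 1, L, m, K, hd, hL⟩ : Params) j) (rep (Mk (⟨d + 1, L, m, K, hd, hL⟩ : Params) j) b.src - rep (Mk (⟨d + 1, L, m, K, hd, hL⟩ : Params) j) y))) := by
    intro b y
    refine (blockBound_DHj_adjoint hc Λ' hj hw lam b y).trans (le_of_eq ?_)
    rw [hcast]
  have hCb : ∀ (b : PBond (⟨d + 1, L, m, K, hd, hL⟩ : Params) j) (y : Site (⟨d + 1, L, m, K, hd, hL⟩ : Params) j),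
      ∑ b' ∈ univ.filter (fun b' : PBond (⟨d + 1, L, m, K, hd, hL⟩ : Params) j => b'.src = y), |(tsV1 hc Λ' w).Ct (EuclideanSpace.single b' (1 : ℝ)) b| ≤
        E / n * Real.exp (-(δC * torusSupNorm (Mk (⟨d + 1, L, m, K, hd, hL⟩ : Params) j) (rep (Mk (⟨d + 1, L, m, K, hd, hL⟩ : Params) j) b.src - rep (Mk (⟨d + 1, L, m, K, hd, hL⟩ : Params) j) y))) :=
    fun b y => hCt m K j hc hj Λ' w hw0 hw1 b y
  -- the tail `C̃^{(j)}_Λ(∇_λH_j)*`: block bound `(E/n^{d+1}·A_H n^{d+1}(d+1)·K₁, δ₁)`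
  have hg : ∀ (b : PBond (⟨d + 1, L, m, K, hd, hL⟩ : Params) j) (y : Site (⟨d + 1, L, m, K, hd, hL⟩ : Params) j), ∑ b₀ ∈ univ.filter (fun b₀ : PBond (⟨d + 1, L, m, K, hd, hL⟩ : Params) 0 => iterBlockOf j b₀.src = y),
      |((tsV1 hc Λ' w).Ct ∘ₗ LinearMap.adjoint (((((L : ℝ) ^ j) • (onE (LinearMap.funLeft ℝ ℝ (fun b : PBond (⟨d + 1, L, m, K, hd, hL⟩ : Params) 0 => (⟨b.src.shift lam, b.dir⟩ : PBond (⟨d + 1, L, m, K, hd, hL⟩ : Params) 0))) - LinearMap.id) : BondSpace (⟨d + 1, L, m, K, hd, hL⟩ : Params) →ₗ[ℝ] BondSpace (⟨d + 1, L, m, K, hd, hL⟩ : Params))) ∘ₗ (tsV1 hc Λ' w).Hj)) (EuclideanSpace.single b₀ (1 : ℝ)) b| ≤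
      E / n * (AH * (n * ((d + 1 : ℕ) : ℝ))) * K₁ * Real.exp (-(δ₁ * torusSupNorm (Mk (⟨d + 1, L, m, K, hd, hL⟩ : Params) j) (rep (Mk (⟨d + 1, L, m, K, hd, hL⟩ : Params) j) b.src - rep (Mk (⟨d + 1, L, m, K, hd, hL⟩ : Params) j) y))) := by
    intro b y
    have h := blockBound_comp hρ hK (tsV1 hc Λ' w).Ct (LinearMap.adjoint (((((L : ℝ) ^ j) • (onE (LinearMap.funLeft ℝ ℝ (fun b : PBond (⟨d + 1, L, m, K, hd, hL⟩ : Params) 0 => (⟨b.src.shift lam, b.dir⟩ : PBond (⟨d + 1, L, m, K, hd, hL⟩ : Params) 0))) - LinearMap.id) : BondSpace (⟨d + 1, L, m, K, hd, hL⟩ : Params) →ₗ[ℝ] BondSpace (⟨d + 1, L, m, K, hd, hL⟩ : Params))) ∘ₗ (tsV1 hc Λ' w).Hj))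
      (fun b : PBond (⟨d + 1, L, m, K, hd, hL⟩ : Params) j => b.src) (fun b : PBond (⟨d + 1, L, m, K, hd, hL⟩ : Params) j => b.src) (fun b₀ : PBond (⟨d + 1, L, m, K, hd, hL⟩ : Params) 0 => iterBlockOf j b₀.src)
      (by positivity : 0 ≤ E / n) (by positivity : 0 ≤ AH * (n * ((d + 1 : ℕ) : ℝ))) hδ₁0.le hδ₁H hδ₁C hCb hTs b y
    rw [hK₁]; exact h
  -- `∇_μ(H_jC̃H_j*)∇_λ* = (∇_μH_j) ∘ C̃ ∘ (∇_λH_j)*` as operators (file M2 §3)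
  have hadj : LinearMap.adjoint (tsV1 hc Λ' w).Hj ∘ₗ ((((L : ℝ) ^ j) • (onE (LinearMap.funLeft ℝ ℝ (fun b : PBond (⟨d + 1, L, m, K, hd, hL⟩ : Params) 0 => (⟨b.src.unshift lam, b.dir⟩ : PBond (⟨d + 1, L, m, K, hd, hL⟩ : Params) 0))) - LinearMap.id) : BondSpace (⟨d + 1, L, m, K, hd, hL⟩ : Params) →ₗ[ℝ] BondSpace (⟨d + 1, L, m, K, hd, hL⟩ : Params))) = LinearMap.adjoint (((((L : ℝ) ^ j) • (onE (LinearMap.funLeft ℝ ℝ (fun b : PBond (⟨d + 1, L, m, K, hd, hL⟩ : Params) 0 => (⟨b.src.shift lam, b.dir⟩ : PBond (⟨d + 1, L, m, K, hd, hL⟩ : Params) 0))) - LinearMap.id) : BondSpace (⟨d + 1, L, m, K, hd, hL⟩ : Params) →ₗ[ℝ] BondSpace (⟨d + 1, L, m, K, hd, hL⟩ : Params))) ∘ₗ (tsV1 hc Λ' w).Hj) := by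
    rw [LinearMap.adjoint_comp ((((L : ℝ) ^ j) • (onE (LinearMap.funLeft ℝ ℝ (fun b : PBond (⟨d + 1, L, m, K, hd, hL⟩ : Params) 0 => (⟨b.src.shift lam, b.dir⟩ : PBond (⟨d + 1, L, m, K, hd, hL⟩ : Params) 0))) - LinearMap.id) : BondSpace (⟨d + 1, L, m, K, hd, hL⟩ : Params) →ₗ[ℝ] BondSpace (⟨d + 1, L, m, K, hd, hL⟩ : Params))) (tsV1 hc Λ' w).Hj, adjoint_Dop]
  have hop : (((((L : ℝ) ^ j) • (onE (LinearMap.funLeft ℝ ℝ (fun b : PBond (⟨d + 1, L, m, K, hd, hL⟩ : Params) 0 => (⟨b.src.shift mu, b.dir⟩ : PBond (⟨d + 1, L, m, K, hd, hL⟩ : Params) 0))) - LinearMap.id) : BondSpace (⟨d + 1, L, m, K, hd, hL⟩ : Params) →ₗ[ℝ] BondSpace (⟨d + 1, L, m, K, hd, hL⟩ : Params))) ∘ₗ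
            (((tsV1 hc Λ' w).Hj ∘ₗ (tsV1 hc Λ' w).Ct ∘ₗ LinearMap.adjoint (tsV1 hc Λ' w).Hj) ∘ₗ ((((L : ℝ) ^ j) • (onE (LinearMap.funLeft ℝ ℝ (fun b : PBond (⟨d + 1, L, m, K, hd, hL⟩ : Params) 0 => (⟨b.src.unshift lam, b.dir⟩ : PBond (⟨d + 1, L, m, K, hd, hL⟩ : Params) 0))) - LinearMap.id) : BondSpace (⟨d + 1, L, m, K, hd, hL⟩ : Params) →ₗ[ℝ] BondSpace (⟨d + 1, L, m, K, hd, hL⟩ : Params))))) =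
      (((((L : ℝ) ^ j) • (onE (LinearMap.funLeft ℝ ℝ (fun b : PBond (⟨d + 1, L, m, K, hd, hL⟩ : Params) 0 => (⟨b.src.shift mu, b.dir⟩ : PBond (⟨d + 1, L, m, K, hd, hL⟩ : Params) 0))) - LinearMap.id) : BondSpace (⟨d + 1, L, m, K, hd, hL⟩ : Params) →ₗ[ℝ] BondSpace (⟨d + 1, L, m, K, hd, hL⟩ : Params))) ∘ₗ (tsV1 hc Λ' w).Hj) ∘ₗ
        (tsV1 hc Λ' w).Ct ∘ₗ
          LinearMap.adjoint (((((L : ℝ) ^ j) • (onE (LinearMap.funLeft ℝ ℝ (fun b : PBond (⟨d + 1, L, m, K, hd, hL⟩ : Params) 0 => (⟨b.src.shift lam, b.dir⟩ : PBond (⟨d + 1, L, m, K, hd, hL⟩ : Params) 0))) - LinearMap.id) : BondSpace (⟨d + 1, L, m, K, hd, hL⟩ : Params) →ₗ[ℝ] BondSpace (⟨d + 1, L, m, K, hd, hL⟩ : Params))) ∘ₗ (tsV1 hc Λ' w).Hj) := by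
    rw [← hadj]
    refine LinearMap.ext fun v => ?_
    simp only [LinearMap.comp_apply]
  rw [hop]
  have h := holderBound_comp hρ hK (((((L : ℝ) ^ j) • (onE (LinearMap.funLeft ℝ ℝ (fun b : PBond (⟨d + 1, L, m, K, hd, hL⟩ : Params) 0 => (⟨b.src.shift mu, b.dir⟩ : PBond (⟨d + 1, L, m, K, hd, hL⟩ : Params) 0))) - LinearMap.id) : BondSpace (⟨d + 1, L, m, K, hd, hL⟩ : Params) →ₗ[ℝ] BondSpace (⟨d + 1, L, m, K, hd, hL⟩ : Params))) ∘ₗ (tsV1 hc Λ' w).Hj) ((tsV1 hc Λ' w).Ct ∘ₗ LinearMap.adjoint (((((L : ℝ) ^ j) • (onE (LinearMap.funLeft ℝ ℝ (fun b : PBond (⟨d + 1, L, m, K, hd, hL⟩ : Params) 0 => (⟨b.src.shift lam, b.dir⟩ : PBond (⟨d + 1, L, m, K, hd, hL⟩ : Params) 0))) - LinearMap.id) : BondSpace (⟨d + 1, L, m, K, hd, hL⟩ : Params) →ₗ[ℝ] BondSpace (⟨d + 1, L, m, K, hd, hL⟩ : Params))) ∘ₗ (tsV1 hc Λ' w).H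j))
    (fun b : PBond (⟨d + 1, L, m, K, hd, hL⟩ : Params) j => b.src) (fun b₀ : PBond (⟨d + 1, L, m, K, hd, hL⟩ : Params) 0 => iterBlockOf j b₀.src) b₁ b₂ (iterBlockOf j b₁.src)
    (by positivity : 0 ≤ CHD d α * ((d + 1 : ℕ) : ℝ) * Real.exp κH * (((supDist b₁.src b₂.src : ℕ) : ℝ) / (L : ℝ) ^ j) ^ α * ((1 * (d + 1) : ℕ) : ℝ))
    (by positivity : 0 ≤ E / n * (AH * (n * ((d + 1 : ℕ) : ℝ))) * K₁)
    hδ'0 hδ'b hδ'a hf hg y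
  refine h.trans (le_of_eq ?_)
  have hn' : E / n * (AH * (n * ((d + 1 : ℕ) : ℝ))) = E * (AH * ((d + 1 : ℕ) : ℝ)) := by
    field_simp
  rw [hn', hC, hAD, hK₁, hK₂]
  ring

/-! ## §4  `(∇_μH_j)Q_j(G^{(n^{d+1})}∇_λ*)` at an `α`-free rate (v1.1) -/

open Classical in
/-- **`(∇_μH_j)Q_j(G^{(n^{d+1})}∇_λ*)` HAS AN EXPONENTIALLY DECAYING PAIR KERNEL WITH A RATE INDEPENDENT OF `α`** (at `c = L^j`): there is `δ > 0` depending on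
`d, L` only and for every `0 ≤ α < 1` a `C_α ≥ 0` with the pair bound `(C_α·t^α, δ)` — the `_rateFree` twin of `holderBound_DHjQGEDadj_scaling` (§2):
first factor `∇_μH_j` by r03's `holderBound_DHj_rateFree` (rate `δ_H(d, L)`), tail `Q_j(G^{(n^{d+1})}∇_λ*)` as in §2.
[cite: Balaban1984PropagatorsII, (2.130)–(2.131) p.246, Prop. 2.5 p.246; Balaban1984PropagatorsI, (1.110) p.35, (1.113) p.36] -/
theorem holderBound_DHjQGEDadj_rateFree (d L : ℕ) (hd : 1 ≤ d + 1) (hL : Odd L ∧ 1 < L) :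
    ∃ δ : ℝ, 0 < δ ∧ ∀ α : ℝ, 0 ≤ α → α < 1 → ∃ C : ℝ, 0 ≤ C ∧ ∀ (m K : ℕ) (j : ℕ) (hc : ((L : ℝ) ^ j) ≠ 0)
      (hj : j + 1 ≤ (⟨d + 1, L, m, K, hd, hL⟩ : Params).m + (⟨d + 1, L, m, K, hd, hL⟩ : Params).K)
      (Λ' : Finset (Site (⟨d + 1, L, m, K, hd, hL⟩ : Params) (j + 1))) (w : CIdx j Λ' → ℝ) (_hw : ∀ i, 0 < w i)
      (hw' : (0 : ℝ) < 1 * ((L : ℝ) ^ j) ^ (d + 1)) (lam mu : Fin (d + 1))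
      (b₁ b₂ : PBond (⟨d + 1, L, m, K, hd, hL⟩ : Params) 0) (_hdir : b₁.dir = b₂.dir) (_hle : supDist b₁.src b₂.src ≤ L ^ j) (y : Site (⟨d + 1, L, m, K, hd, hL⟩ : Params) j),
      ∑ b₀' ∈ univ.filter (fun b₀' : PBond (⟨d + 1, L, m, K, hd, hL⟩ : Params) 0 => iterBlockOf j b₀'.src = y),
          |((((((L : ℝ) ^ j) • (onE (LinearMap.funLeft ℝ ℝ (fun b : PBond (⟨d + 1, L, m, K, hd, hL⟩ : Params) 0 => (⟨b.src.shift mu, b.dir⟩ : PBond (⟨d + 1, L, m, K, hd, hL⟩ : Params) 0))) - LinearMap.id) : BondSpace (⟨d + 1, L, m, K, hd, hL⟩ : Params) →ₗ[ℝ] BondSpace (⟨d + 1, L, m, K, hd, hL⟩ : Params))) ∘ₗ (tsV1 hc Λ' w).Hj) ∘ₗ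
            ((tsV1 hc Λ' w).Qv ∘ₗ (GE (Domains.whole (P := (⟨d + 1, L, m, K, hd, hL⟩ : Params)) j (Nat.le_of_succ_le hj)) hc (w := fun _ => 1 * ((L : ℝ) ^ j) ^ (d + 1)) (fun _ => hw') ∘ₗ
              ((((L : ℝ) ^ j) • (onE (LinearMap.funLeft ℝ ℝ (fun b : PBond (⟨d + 1, L, m, K, hd, hL⟩ : Params) 0 => (⟨b.src.unshift lam, b.dir⟩ : PBond (⟨d + 1, L, m, K, hd, hL⟩ : Params) 0))) - LinearMap.id) : BondSpace (⟨d + 1, L, m, K, hd, hL⟩ : Params) →ₗ[ℝ] BondSpace (⟨d + 1, L, m, K, hd, hL⟩ : Params)))))) (EuclideanSpace.single b₀' (1 : ℝ)) b₁ -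
           ((((((L : ℝ) ^ j) • (onE (LinearMap.funLeft ℝ ℝ (fun b : PBond (⟨d + 1, L, m, K, hd, hL⟩ : Params) 0 => (⟨b.src.shift mu, b.dir⟩ : PBond (⟨d + 1, L, m, K, hd, hL⟩ : Params) 0))) - LinearMap.id) : BondSpace (⟨d + 1, L, m, K, hd, hL⟩ : Params) →ₗ[ℝ] BondSpace (⟨d + 1, L, m, K, hd, hL⟩ : Params))) ∘ₗ (tsV1 hc Λ' w).Hj) ∘ₗ
            ((tsV1 hc Λ' w).Qv ∘ₗ (GE (Domains.whole (P := (⟨d + 1, L, m, K, hd, hL⟩ : Params)) j (Nat.le_of_succ_le hj)) hc (w := fun _ => 1 * ((L : ℝ) ^ j) ^ (d + 1)) (fun _ => hw') ∘ₗ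
              ((((L : ℝ) ^ j) • (onE (LinearMap.funLeft ℝ ℝ (fun b : PBond (⟨d + 1, L, m, K, hd, hL⟩ : Params) 0 => (⟨b.src.unshift lam, b.dir⟩ : PBond (⟨d + 1, L, m, K, hd, hL⟩ : Params) 0))) - LinearMap.id) : BondSpace (⟨d + 1, L, m, K, hd, hL⟩ : Params) →ₗ[ℝ] BondSpace (⟨d + 1, L, m, K, hd, hL⟩ : Params)))))) (EuclideanSpace.single b₀' (1 : ℝ)) b₂| ≤
        C * (((supDist b₁.src b₂.src : ℕ) : ℝ) / (L : ℝ) ^ j) ^ α * Real.exp (-(δ * torusSupNorm (Mk (⟨d + 1, L, m, K, hd, hL⟩ : Params) j) (rep (Mk (⟨d + 1, L, m, K, hd, hL⟩ : Params) j) (iterBlockOf j b₁.src) - rep (Mk (⟨d + 1, L, m, K, hd, hL⟩ : Params) j) y))) := by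
  obtain ⟨δD, hδD, CD, hCD, hDG⟩ := blockBound_GEDadj_scaling d L hd hL one_pos
  obtain ⟨δH, hδH, HH⟩ := holderBound_DHj_rateFree d L hd hL
  set κH : ℝ := kappa163 (d + 1) / ((d : ℝ) + 1) with hκH
  have hκH0 : 0 < κH := div_pos (kappa163_pos _) (by positivity)
  -- rates: the tail at `δ₁ = min(δ_D, κ_H/2)`; the product at `δ = min(δ₁, δ_H/2)` — independent of `α`
  set δ₁ : ℝ := min δD (κH / 2) with hδ₁
  have hδ₁0 : 0 < δ₁ := lt_min hδD (half_pos hκH0)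
  have hδ₁D : δ₁ ≤ δD := min_le_left _ _
  have hδ₁H : δ₁ < κH := lt_of_le_of_lt (min_le_right _ _) (half_lt_self hκH0)
  set δ : ℝ := min δ₁ (δH / 2) with hδ
  have hδ0 : 0 < δ := lt_min hδ₁0 (half_pos hδH)
  have hδδ₁ : δ ≤ δ₁ := min_le_left _ _
  have hδH' : δ < δH := lt_of_le_of_lt (min_le_right _ _) (half_lt_self hδH)
  set K₁ : ℝ := latticeConst (d + 1) (κH - δ₁) with hK₁
  have hK₁0 : 0 ≤ K₁ := latticeConst_nonneg _ (by linarith)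
  set K₂ : ℝ := latticeConst (d + 1) (δH - δ) with hK₂
  have hK₂0 : 0 ≤ K₂ := latticeConst_nonneg _ (by linarith)
  have hL0 : 0 < L := by have := hL.2; omega
  haveI : NeZero L := ⟨by omega⟩
  have hLp : (0 : ℝ) < L := by exact_mod_cast hL0
  refine ⟨δ, hδ0, fun α hα0 hα1 => ?_⟩
  obtain ⟨CH, hCH, hH⟩ := HH α hα0 hα1
  set C : ℝ := CH * (Real.exp κH * CD * K₁) * K₂ with hC
  have hC0 : 0 ≤ C := by positivity
  refine ⟨C, hC0, ?_⟩
  intro m K j hc hj Λ' w hw hw' lam mu b₁ b₂ hdir hle y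
  have hj' : j ≤ m + K := Nat.le_of_succ_le hj
  have hLj : (0 : ℝ) < (L : ℝ) ^ j := by positivity
  have ht0 : 0 ≤ (((supDist b₁.src b₂.src : ℕ) : ℝ) / (L : ℝ) ^ j) ^ α := Real.rpow_nonneg (by positivity) _
  have hρ : IsPseudoDist (fun t t' : Site (⟨d + 1, L, m, K, hd, hL⟩ : Params) j => torusSupNorm (Mk (⟨d + 1, L, m, K, hd, hL⟩ : Params) j) (rep (Mk (⟨d + 1, L, m, K, hd, hL⟩ : Params) j) t - rep (Mk (⟨d + 1, L, m, K, hd, hL⟩ : Params) j) t')) := torusDist_isPseudoDist (Mk (⟨d + 1, L, m, K, hd, hL⟩ : Params) j)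
  have hK : SumBound (fun t t' : Site (⟨d + 1, L, m, K, hd, hL⟩ : Params) j => torusSupNorm (Mk (⟨d + 1, L, m, K, hd, hL⟩ : Params) j) (rep (Mk (⟨d + 1, L, m, K, hd, hL⟩ : Params) j) t - rep (Mk (⟨d + 1, L, m, K, hd, hL⟩ : Params) j) t')) (fun a => latticeConst (d + 1) a) := torusDist_sumBound (Mk (⟨d + 1, L, m, K, hd, hL⟩ : Params) j)
  -- the first factor `∇_μH_j` at the `α`-free rate `δ_H` (r03)
  have hf : ∀ y' : Site (⟨d + 1, L, m, K, hd, hL⟩ : Params) j, ∑ b ∈ univ.filter (fun b : PBond (⟨d + 1, L, m, K, hd, hL⟩ : Params) j => b.src = y'),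
      |(((((L : ℝ) ^ j) • (onE (LinearMap.funLeft ℝ ℝ (fun b : PBond (⟨d + 1, L, m, K, hd, hL⟩ : Params) 0 => (⟨b.src.shift mu, b.dir⟩ : PBond (⟨d + 1, L, m, K, hd, hL⟩ : Params) 0))) - LinearMap.id) : BondSpace (⟨d + 1, L, m, K, hd, hL⟩ : Params) →ₗ[ℝ] BondSpace (⟨d + 1, L, m, K, hd, hL⟩ : Params))) ∘ₗ (tsV1 hc Λ' w).Hj) (EuclideanSpace.single b (1 : ℝ)) b₁ -
       (((((L : ℝ) ^ j) • (onE (LinearMap.funLeft ℝ ℝ (fun b : PBond (⟨d + 1, L, m, K, hd, hL⟩ : Params) 0 => (⟨b.src.shift mu, b.dir⟩ : PBond (⟨d + 1, L, m, K, hd, hL⟩ : Params) 0))) - LinearMap.id) : BondSpace (⟨d + 1, L, m, K, hd, hL⟩ : Params) →ₗ[ℝ] BondSpace (⟨d + 1, L, m, K, hd, hL⟩ : Params))) ∘ₗ (tsV1 hc Λ' w).Hj) (EuclideanSpace.single b (1 : ℝ)) b₂| ≤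
      CH * (((supDist b₁.src b₂.src : ℕ) : ℝ) / (L : ℝ) ^ j) ^ α * Real.exp (-(δH * torusSupNorm (Mk (⟨d + 1, L, m, K, hd, hL⟩ : Params) j) (rep (Mk (⟨d + 1, L, m, K, hd, hL⟩ : Params) j) (iterBlockOf j b₁.src) - rep (Mk (⟨d + 1, L, m, K, hd, hL⟩ : Params) j) y'))) :=
    fun y' => hH m K j hc hj Λ' w hw mu b₁ b₂ hdir hle y'
  -- the tail `Q_j ∘ (G^{(n^{d+1})}∇_λ*)` at the rate `δ₁` (as in §2)
  have hDGb := hDG m K j hj' hc hw' lam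
  have hQ := blockBound_Qv hc hj' Λ' w hκH0.le
  have hg' := blockBound_comp hρ hK (tsV1 hc Λ' w).Qv (GE (Domains.whole (P := (⟨d + 1, L, m, K, hd, hL⟩ : Params)) j hj') hc (w := fun _ => 1 * ((L : ℝ) ^ j) ^ (d + 1)) (fun _ => hw') ∘ₗ ((((L : ℝ) ^ j) • (onE (LinearMap.funLeft ℝ ℝ (fun b : PBond (⟨d + 1, L, m, K, hd, hL⟩ : Params) 0 => (⟨b.src.unshift lam, b.dir⟩ : PBond (⟨d + 1, L, m, K, hd, hL⟩ : Params) 0))) - LinearMap.id) : BondSpace (⟨d + 1, L, m, K, hd, hL⟩ : Params) →ₗ[ℝ] BondSpace (⟨d + 1, L, m, K, hd, hL⟩ : Params))))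
    (fun b : PBond (⟨d + 1, L, m, K, hd, hL⟩ : Params) j => b.src) (fun b₀ : PBond (⟨d + 1, L, m, K, hd, hL⟩ : Params) 0 => iterBlockOf j b₀.src) (fun b₀ : PBond (⟨d + 1, L, m, K, hd, hL⟩ : Params) 0 => iterBlockOf j b₀.src)
    (Cf := Real.exp κH) (Cg := CD) (by positivity) hCD hδ₁0.le hδ₁D hδ₁H hQ hDGb
  have hg : ∀ (b : PBond (⟨d + 1, L, m, K, hd, hL⟩ : Params) j) (y : Site (⟨d + 1, L, m, K, hd, hL⟩ : Params) j), ∑ b₀ ∈ univ.filter (fun b₀ : PBond (⟨d + 1, L, m, K, hd, hL⟩ : Params) 0 => iterBlockOf j b₀.src = y),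
      |((tsV1 hc Λ' w).Qv ∘ₗ (GE (Domains.whole (P := (⟨d + 1, L, m, K, hd, hL⟩ : Params)) j hj') hc (w := fun _ => 1 * ((L : ℝ) ^ j) ^ (d + 1)) (fun _ => hw') ∘ₗ ((((L : ℝ) ^ j) • (onE (LinearMap.funLeft ℝ ℝ (fun b : PBond (⟨d + 1, L, m, K, hd, hL⟩ : Params) 0 => (⟨b.src.unshift lam, b.dir⟩ : PBond (⟨d + 1, L, m, K, hd, hL⟩ : Params) 0))) - LinearMap.id) : BondSpace (⟨d + 1, L, m, K, hd, hL⟩ : Params) →ₗ[ℝ] BondSpace (⟨d + 1, L, m, K, hd, hL⟩ : Params))))) (EuclideanSpace.single b₀ (1 : ℝ)) b| ≤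
      Real.exp κH * CD * K₁ * Real.exp (-(δ₁ * torusSupNorm (Mk (⟨d + 1, L, m, K, hd, hL⟩ : Params) j) (rep (Mk (⟨d + 1, L, m, K, hd, hL⟩ : Params) j) b.src - rep (Mk (⟨d + 1, L, m, K, hd, hL⟩ : Params) j) y))) := by
    intro b y
    have h := hg' b y
    rw [hK₁]; exact h
  have h := holderBound_comp hρ hK (((((L : ℝ) ^ j) • (onE (LinearMap.funLeft ℝ ℝ (fun b : PBond (⟨d + 1, L, m, K, hd, hL⟩ : Params) 0 => (⟨b.src.shift mu, b.dir⟩ : PBond (⟨d + 1, L, m, K, hd, hL⟩ : Params) 0))) - LinearMap.id) : BondSpace (⟨d + 1, L, m, K, hd, hL⟩ : Params) →ₗ[ℝ] BondSpace (⟨d + 1, L, m, K, hd, hL⟩ : Params))) ∘ₗ (tsV1 hc Λ' w).Hj) ((tsV1 hc Λ' w).Qv ∘ₗ (GE (Domains.whole (P := (⟨d + 1, L, m, K, hd, hL⟩ : Params)) j hj') hc (w := fun _ => 1 * ((L : ℝ) ^ j) ^ (d + 1)) (fun _ => hw') ∘ₗ ((((L : ℝ) ^ j) • (onE (LinearMap.funLeft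 ℝ ℝ (fun b : PBond (⟨d + 1, L, m, K, hd, hL⟩ : Params) 0 => (⟨b.src.unshift lam, b.dir⟩ : PBond (⟨d + 1, L, m, K, hd, hL⟩ : Params) 0))) - LinearMap.id) : BondSpace (⟨d + 1, L, m, K, hd, hL⟩ : Params) →ₗ[ℝ] BondSpace (⟨d + 1, L, m, K, hd, hL⟩ : Params)))))
    (fun b : PBond (⟨d + 1, L, m, K, hd, hL⟩ : Params) j => b.src) (fun b₀ : PBond (⟨d + 1, L, m, K, hd, hL⟩ : Params) 0 => iterBlockOf j b₀.src) b₁ b₂ (iterBlockOf j b₁.src)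
    (by positivity : 0 ≤ CH * (((supDist b₁.src b₂.src : ℕ) : ℝ) / (L : ℝ) ^ j) ^ α) (by positivity : 0 ≤ Real.exp κH * CD * K₁)
    hδ0.le hδδ₁ hδH' hf hg y
  refine h.trans (le_of_eq ?_)
  rw [hC, hK₁, hK₂]
  ring

/-! ## §5  `(∇_μH_j)C̃^{(j)}_Λ(∇_λH_j)*` at an `α`-free rate (v1.1) -/

open Classical in
/-- **`(∇_μH_j)C̃^{(j)}_Λ(∇_λH_j)*` HAS AN EXPONENTIALLY DECAYING PAIR KERNEL WITH A RATE INDEPENDENT OF `α`** (at `c = L^j`, weights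
`a₀n^{d+1} ≤ w ≤ a₁n^{d+1}`): there is `δ > 0` (on `d, L, a₀, a₁`) and for every `0 ≤ α < 1` a `C_α ≥ 0` with the pair bound `(C_α·t^α, δ)` — the
`_rateFree` twin of `holderBound_DHjCtDHjadj_scaling` (§3): first factor by r03's `holderBound_DHj_rateFree`, tail as in §3.
[cite: Balaban1984PropagatorsII, Prop. 2.5 p.246, (2.130) p.246; Balaban1984PropagatorsI, (1.113) p.36] -/
theorem holderBound_DHjCtDHjadj_rateFree (d L : ℕ) (hd : 1 ≤ d + 1) (hL : Odd L ∧ 1 < L) {a₀ a₁ : ℝ} (ha₀ : 0 < a₀) (ha₁ : a₀ ≤ a₁) :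
    ∃ δ : ℝ, 0 < δ ∧ ∀ α : ℝ, 0 ≤ α → α < 1 → ∃ C : ℝ, 0 ≤ C ∧ ∀ (m K : ℕ) (j : ℕ) (hc : ((L : ℝ) ^ j) ≠ 0)
      (_hj : j + 1 ≤ (⟨d + 1, L, m, K, hd, hL⟩ : Params).m + (⟨d + 1, L, m, K, hd, hL⟩ : Params).K)
      (Λ' : Finset (Site (⟨d + 1, L, m, K, hd, hL⟩ : Params) (j + 1))) (w : CIdx j Λ' → ℝ)
      (_hw0 : ∀ i, a₀ * ((L : ℝ) ^ j) ^ (d + 1) ≤ w i) (_hw1 : ∀ i, w i ≤ a₁ * ((L : ℝ) ^ j) ^ (d + 1)) (lam mu : Fin (d + 1))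
      (b₁ b₂ : PBond (⟨d + 1, L, m, K, hd, hL⟩ : Params) 0) (_hdir : b₁.dir = b₂.dir) (_hle : supDist b₁.src b₂.src ≤ L ^ j) (y : Site (⟨d + 1, L, m, K, hd, hL⟩ : Params) j),
      ∑ b₀' ∈ univ.filter (fun b₀' : PBond (⟨d + 1, L, m, K, hd, hL⟩ : Params) 0 => iterBlockOf j b₀'.src = y),
          |(((((L : ℝ) ^ j) • (onE (LinearMap.funLeft ℝ ℝ (fun b : PBond (⟨d + 1, L, m, K, hd, hL⟩ : Params) 0 => (⟨b.src.shift mu, b.dir⟩ : PBond (⟨d + 1, L, m, K, hd, hL⟩ : Params) 0))) - LinearMap.id) : BondSpace (⟨d + 1, L, m, K, hd, hL⟩ : Params) →ₗ[ℝ] BondSpace (⟨d + 1, L, m, K, hd, hL⟩ : Params))) ∘ₗ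
            (((tsV1 hc Λ' w).Hj ∘ₗ (tsV1 hc Λ' w).Ct ∘ₗ LinearMap.adjoint (tsV1 hc Λ' w).Hj) ∘ₗ ((((L : ℝ) ^ j) • (onE (LinearMap.funLeft ℝ ℝ (fun b : PBond (⟨d + 1, L, m, K, hd, hL⟩ : Params) 0 => (⟨b.src.unshift lam, b.dir⟩ : PBond (⟨d + 1, L, m, K, hd, hL⟩ : Params) 0))) - LinearMap.id) : BondSpace (⟨d + 1, L, m, K, hd, hL⟩ : Params) →ₗ[ℝ] BondSpace (⟨d + 1, L, m, K, hd, hL⟩ : Params))))) (EuclideanSpace.single b₀' (1 : ℝ)) b₁ -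
           (((((L : ℝ) ^ j) • (onE (LinearMap.funLeft ℝ ℝ (fun b : PBond (⟨d + 1, L, m, K, hd, hL⟩ : Params) 0 => (⟨b.src.shift mu, b.dir⟩ : PBond (⟨d + 1, L, m, K, hd, hL⟩ : Params) 0))) - LinearMap.id) : BondSpace (⟨d + 1, L, m, K, hd, hL⟩ : Params) →ₗ[ℝ] BondSpace (⟨d + 1, L, m, K, hd, hL⟩ : Params))) ∘ₗ
            (((tsV1 hc Λ' w).Hj ∘ₗ (tsV1 hc Λ' w).Ct ∘ₗ LinearMap.adjoint (tsV1 hc Λ' w).Hj) ∘ₗ ((((L : ℝ) ^ j) • (onE (LinearMap.funLeft ℝ ℝ (fun b : PBond (⟨d + 1, L, m, K, hd, hL⟩ : Params) 0 => (⟨b.src.unshift lam, b.dir⟩ : PBond (⟨d + 1, L, m, K, hd, hL⟩ : Params) 0))) - LinearMap.id) : BondSpace (⟨d + 1, L, m, K, hd, hL⟩ : Params) →ₗ[ℝ] BondSpace (⟨d + 1, L, m, K, hd, hL⟩ : Params))))) (EuclideanSpace.single b₀' (1 : ℝ)) b₂| ≤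
        C * (((supDist b₁.src b₂.src : ℕ) : ℝ) / (L : ℝ) ^ j) ^ α * Real.exp (-(δ * torusSupNorm (Mk (⟨d + 1, L, m, K, hd, hL⟩ : Params) j) (rep (Mk (⟨d + 1, L, m, K, hd, hL⟩ : Params) j) (iterBlockOf j b₁.src) - rep (Mk (⟨d + 1, L, m, K, hd, hL⟩ : Params) j) y))) := by
  obtain ⟨δC, hδC, E, hE, hCt⟩ := blockBound_Ct_scaling d L hd hL ha₀ ha₁
  obtain ⟨δH, hδH, HH⟩ := holderBound_DHj_rateFree d L hd hL
  set κH : ℝ := kappa163 (d + 1) / ((d : ℝ) + 1) with hκH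
  have hκH0 : 0 < κH := div_pos (kappa163_pos _) (by positivity)
  -- rates: the tail at `δ₁ = min(δ_C/2, κ_H)`; the product at `δ = min(δ₁, δ_H/2)` — independent of `α`
  set δ₁ : ℝ := min (δC / 2) κH with hδ₁
  have hδ₁0 : 0 < δ₁ := lt_min (half_pos hδC) hκH0
  have hδ₁C : δ₁ < δC := lt_of_le_of_lt (min_le_left _ _) (half_lt_self hδC)
  have hδ₁H : δ₁ ≤ κH := min_le_right _ _
  set δ : ℝ := min δ₁ (δH / 2) with hδ
  have hδ0 : 0 < δ := lt_min hδ₁0 (half_pos hδH)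
  have hδδ₁ : δ ≤ δ₁ := min_le_left _ _
  have hδH' : δ < δH := lt_of_le_of_lt (min_le_right _ _) (half_lt_self hδH)
  set K₁ : ℝ := latticeConst (d + 1) (δC - δ₁) with hK₁
  have hK₁0 : 0 ≤ K₁ := latticeConst_nonneg _ (by linarith)
  set K₂ : ℝ := latticeConst (d + 1) (δH - δ) with hK₂
  have hK₂0 : 0 ≤ K₂ := latticeConst_nonneg _ (by linarith)
  have hL0 : 0 < L := by have := hL.2; omega
  haveI : NeZero L := ⟨by omega⟩
  have hLp : (0 : ℝ) < L := by exact_mod_cast hL0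
  set AH : ℝ := CdecD d with hAH
  have hAH0 : 0 ≤ AH := CdecD_nonneg (d := d)
  refine ⟨δ, hδ0, fun α hα0 hα1 => ?_⟩
  obtain ⟨CH, hCH, hH⟩ := HH α hα0 hα1
  set C : ℝ := CH * (E * (AH * ((d + 1 : ℕ) : ℝ)) * K₁) * K₂ with hC
  have hC0 : 0 ≤ C := by positivity
  refine ⟨C, hC0, ?_⟩
  intro m K j hc hj Λ' w hw0 hw1 lam mu b₁ b₂ hdir hle y
  have hj' : j ≤ m + K := Nat.le_of_succ_le hj
  set n : ℝ := ((L : ℝ) ^ j) ^ (d + 1) with hn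
  have hn0 : 0 < n := by positivity
  have hLj : (0 : ℝ) < (L : ℝ) ^ j := by positivity
  have hw : ∀ i, 0 < w i := fun i => lt_of_lt_of_le (by positivity) (hw0 i)
  have ht0 : 0 ≤ (((supDist b₁.src b₂.src : ℕ) : ℝ) / (L : ℝ) ^ j) ^ α := Real.rpow_nonneg (by positivity) _
  have hρ : IsPseudoDist (fun t t' : Site (⟨d + 1, L, m, K, hd, hL⟩ : Params) j => torusSupNorm (Mk (⟨d + 1, L, m, K, hd, hL⟩ : Params) j) (rep (Mk (⟨d + 1, L, m, K, hd, hL⟩ : Params) j) t - rep (Mk (⟨d + 1, L, m, K, hd, hL⟩ : Params) j) t')) := torusDist_isPseudoDist (Mk (⟨d + 1, L, m, K, hd, hL⟩ : Params) j)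
  have hK : SumBound (fun t t' : Site (⟨d + 1, L, m, K, hd, hL⟩ : Params) j => torusSupNorm (Mk (⟨d + 1, L, m, K, hd, hL⟩ : Params) j) (rep (Mk (⟨d + 1, L, m, K, hd, hL⟩ : Params) j) t - rep (Mk (⟨d + 1, L, m, K, hd, hL⟩ : Params) j) t')) (fun a => latticeConst (d + 1) a) := torusDist_sumBound (Mk (⟨d + 1, L, m, K, hd, hL⟩ : Params) j)
  have hcast : (((L ^ j) ^ (d + 1) * (d + 1) : ℕ) : ℝ) = n * ((d + 1 : ℕ) : ℝ) := by rw [hn]; push_cast; ring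
  -- the first factor `∇_μH_j` at the `α`-free rate `δ_H` (r03)
  have hf : ∀ y' : Site (⟨d + 1, L, m, K, hd, hL⟩ : Params) j, ∑ b ∈ univ.filter (fun b : PBond (⟨d + 1, L, m, K, hd, hL⟩ : Params) j => b.src = y'),
      |(((((L : ℝ) ^ j) • (onE (LinearMap.funLeft ℝ ℝ (fun b : PBond (⟨d + 1, L, m, K, hd, hL⟩ : Params) 0 => (⟨b.src.shift mu, b.dir⟩ : PBond (⟨d + 1, L, m, K, hd, hL⟩ : Params) 0))) - LinearMap.id) : BondSpace (⟨d + 1, L, m, K, hd, hL⟩ : Params) →ₗ[ℝ] BondSpace (⟨d + 1, L, m, K, hd, hL⟩ : Params))) ∘ₗ (tsV1 hc Λ' w).Hj) (EuclideanSpace.single b (1 : ℝ)) b₁ -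
       (((((L : ℝ) ^ j) • (onE (LinearMap.funLeft ℝ ℝ (fun b : PBond (⟨d + 1, L, m, K, hd, hL⟩ : Params) 0 => (⟨b.src.shift mu, b.dir⟩ : PBond (⟨d + 1, L, m, K, hd, hL⟩ : Params) 0))) - LinearMap.id) : BondSpace (⟨d + 1, L, m, K, hd, hL⟩ : Params) →ₗ[ℝ] BondSpace (⟨d + 1, L, m, K, hd, hL⟩ : Params))) ∘ₗ (tsV1 hc Λ' w).Hj) (EuclideanSpace.single b (1 : ℝ)) b₂| ≤
      CH * (((supDist b₁.src b₂.src : ℕ) : ℝ) / (L : ℝ) ^ j) ^ α * Real.exp (-(δH * torusSupNorm (Mk (⟨d + 1, L, m, K, hd, hL⟩ : Params) j) (rep (Mk (⟨d + 1, L, m, K, hd, hL⟩ : Params) j) (iterBlockOf j b₁.src) - rep (Mk (⟨d + 1, L, m, K, hd, hL⟩ : Params) j) y'))) :=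
    fun y' => hH m K j hc hj Λ' w hw mu b₁ b₂ hdir hle y'
  -- the tail factors (p22): `(∇_λH_j)*` `(A_H n^{d+1}(d+1), κ_H)`, `C̃^{(j)}_Λ` `(E/n^{d+1}, δ_C)`
  have hTs : ∀ (b : PBond (⟨d + 1, L, m, K, hd, hL⟩ : Params) j) (y : Site (⟨d + 1, L, m, K, hd, hL⟩ : Params) j),
      ∑ b₀ ∈ univ.filter (fun b₀ : PBond (⟨d + 1, L, m, K, hd, hL⟩ : Params) 0 => iterBlockOf j b₀.src = y),
          |LinearMap.adjoint (((((L : ℝ) ^ j) • (onE (LinearMap.funLeft ℝ ℝ (fun b : PBond (⟨d + 1, L, m, K, hd, hL⟩ : Params) 0 => (⟨b.src.shift lam, b.dir⟩ : PBond (⟨d + 1, L, m, K, hd, hL⟩ : Params) 0))) - LinearMap.id) : BondSpace (⟨d + 1, L, m, K, hd, hL⟩ : Params) →ₗ[ℝ] BondSpace (⟨d + 1, L, m, K, hd, hL⟩ : Params))) ∘ₗ (tsV1 hc Λ' w).Hj) (EuclideanSpace.single b₀ (1 : ℝ)) b| ≤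
        AH * (n * ((d + 1 : ℕ) : ℝ)) * Real.exp (-(κH * torusSupNorm (Mk (⟨d + 1, L, m, K, hd, hL⟩ : Params) j) (rep (Mk (⟨d + 1, L, m, K, hd, hL⟩ : Params) j) b.src - rep (Mk (⟨d + 1, L, m, K, hd, hL⟩ : Params) j) y))) := by
    intro b y
    refine (blockBound_DHj_adjoint hc Λ' hj hw lam b y).trans (le_of_eq ?_)
    rw [hcast]
  have hCb : ∀ (b : PBond (⟨d + 1, L, m, K, hd, hL⟩ : Params) j) (y : Site (⟨d + 1, L, m, K, hd, hL⟩ : Params) j),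
      ∑ b' ∈ univ.filter (fun b' : PBond (⟨d + 1, L, m, K, hd, hL⟩ : Params) j => b'.src = y), |(tsV1 hc Λ' w).Ct (EuclideanSpace.single b' (1 : ℝ)) b| ≤
        E / n * Real.exp (-(δC * torusSupNorm (Mk (⟨d + 1, L, m, K, hd, hL⟩ : Params) j) (rep (Mk (⟨d + 1, L, m, K, hd, hL⟩ : Params) j) b.src - rep (Mk (⟨d + 1, L, m, K, hd, hL⟩ : Params) j) y))) :=
    fun b y => hCt m K j hc hj Λ' w hw0 hw1 b y
  have hg : ∀ (b : PBond (⟨d + 1, L, m, K, hd, hL⟩ : Params) j) (y : Site (⟨d + 1, L, m, K, hd, hL⟩ : Params) j), ∑ b₀ ∈ univ.filter (fun b₀ : PBond (⟨d + 1, L, m, K, hd, hL⟩ : Params) 0 => iterBlockOf j b₀.src = y),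
      |((tsV1 hc Λ' w).Ct ∘ₗ LinearMap.adjoint (((((L : ℝ) ^ j) • (onE (LinearMap.funLeft ℝ ℝ (fun b : PBond (⟨d + 1, L, m, K, hd, hL⟩ : Params) 0 => (⟨b.src.shift lam, b.dir⟩ : PBond (⟨d + 1, L, m, K, hd, hL⟩ : Params) 0))) - LinearMap.id) : BondSpace (⟨d + 1, L, m, K, hd, hL⟩ : Params) →ₗ[ℝ] BondSpace (⟨d + 1, L, m, K, hd, hL⟩ : Params))) ∘ₗ (tsV1 hc Λ' w).Hj)) (EuclideanSpace.single b₀ (1 : ℝ)) b| ≤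
      E / n * (AH * (n * ((d + 1 : ℕ) : ℝ))) * K₁ * Real.exp (-(δ₁ * torusSupNorm (Mk (⟨d + 1, L, m, K, hd, hL⟩ : Params) j) (rep (Mk (⟨d + 1, L, m, K, hd, hL⟩ : Params) j) b.src - rep (Mk (⟨d + 1, L, m, K, hd, hL⟩ : Params) j) y))) := by
    intro b y
    have h := blockBound_comp hρ hK (tsV1 hc Λ' w).Ct (LinearMap.adjoint (((((L : ℝ) ^ j) • (onE (LinearMap.funLeft ℝ ℝ (fun b : PBond (⟨d + 1, L, m, K, hd, hL⟩ : Params) 0 => (⟨b.src.shift lam, b.dir⟩ : PBond (⟨d + 1, L, m, K, hd, hL⟩ : Params) 0))) - LinearMap.id) : BondSpace (⟨d + 1, L, m, K, hd, hL⟩ : Params) →ₗ[ℝ] BondSpace (⟨d + 1, L, m, K, hd, hL⟩ : Params))) ∘ₗ (tsV1 hc Λ' w).Hj))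
      (fun b : PBond (⟨d + 1, L, m, K, hd, hL⟩ : Params) j => b.src) (fun b : PBond (⟨d + 1, L, m, K, hd, hL⟩ : Params) j => b.src) (fun b₀ : PBond (⟨d + 1, L, m, K, hd, hL⟩ : Params) 0 => iterBlockOf j b₀.src)
      (by positivity : 0 ≤ E / n) (by positivity : 0 ≤ AH * (n * ((d + 1 : ℕ) : ℝ))) hδ₁0.le hδ₁H hδ₁C hCb hTs b y
    rw [hK₁]; exact h
  -- the operator identity of §3 / file M2 §3
  have hadj : LinearMap.adjoint (tsV1 hc Λ' w).Hj ∘ₗ ((((L : ℝ) ^ j) • (onE (LinearMap.funLeft ℝ ℝ (fun b : PBond (⟨d + 1, L, m, K, hd, hL⟩ : Params) 0 => (⟨b.src.unshift lam, b.dir⟩ : PBond (⟨d + 1, L, m, K, hd, hL⟩ : Params) 0))) - LinearMap.id) : BondSpace (⟨d + 1, L, m, K, hd, hL⟩ : Params) →ₗ[ℝ] BondSpace (⟨d + 1, L, m, K, hd, hL⟩ : Params))) = LinearMap.adjoint (((((L : ℝ) ^ j) • (onE (LinearMap.funLeft ℝ ℝ (fun b : PBond (⟨d + 1, L, m, K,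 hd, hL⟩ : Params) 0 => (⟨b.src.shift lam, b.dir⟩ : PBond (⟨d + 1, L, m, K, hd, hL⟩ : Params) 0))) - LinearMap.id) : BondSpace (⟨d + 1, L, m, K, hd, hL⟩ : Params) →ₗ[ℝ] BondSpace (⟨d + 1, L, m, K, hd, hL⟩ : Params))) ∘ₗ (tsV1 hc Λ' w).Hj) := by
    rw [LinearMap.adjoint_comp ((((L : ℝ) ^ j) • (onE (LinearMap.funLeft ℝ ℝ (fun b : PBond (⟨d + 1, L, m, K, hd, hL⟩ : Params) 0 => (⟨b.src.shift lam, b.dir⟩ : PBond (⟨d + 1, L, m, K, hd, hL⟩ : Params) 0))) - LinearMap.id) : BondSpace (⟨d + 1, L, m, K, hd, hL⟩ : Params) →ₗ[ℝ] BondSpace (⟨d + 1, L, m, K, hd, hL⟩ : Params))) (tsV1 hc Λ' w).Hj, adjoint_Dop]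
  have hop : (((((L : ℝ) ^ j) • (onE (LinearMap.funLeft ℝ ℝ (fun b : PBond (⟨d + 1, L, m, K, hd, hL⟩ : Params) 0 => (⟨b.src.shift mu, b.dir⟩ : PBond (⟨d + 1, L, m, K, hd, hL⟩ : Params) 0))) - LinearMap.id) : BondSpace (⟨d + 1, L, m, K, hd, hL⟩ : Params) →ₗ[ℝ] BondSpace (⟨d + 1, L, m, K, hd, hL⟩ : Params))) ∘ₗ
            (((tsV1 hc Λ' w).Hj ∘ₗ (tsV1 hc Λ' w).Ct ∘ₗ LinearMap.adjoint (tsV1 hc Λ' w).Hj) ∘ₗ ((((L : ℝ) ^ j) • (onE (LinearMap.funLeft ℝ ℝ (fun b : PBond (⟨d + 1, L, m, K, hd, hL⟩ : Params) 0 => (⟨b.src.unshift lam, b.dir⟩ : PBond (⟨d + 1, L, m, K, hd, hL⟩ : Params) 0))) - LinearMap.id) : BondSpace (⟨d + 1, L, m, K, hd, hL⟩ : Params) →ₗ[ℝ] BondSpace (⟨d + 1, L, m, K, hd, hL⟩ : Params))))) =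
      (((((L : ℝ) ^ j) • (onE (LinearMap.funLeft ℝ ℝ (fun b : PBond (⟨d + 1, L, m, K, hd, hL⟩ : Params) 0 => (⟨b.src.shift mu, b.dir⟩ : PBond (⟨d + 1, L, m, K, hd, hL⟩ : Params) 0))) - LinearMap.id) : BondSpace (⟨d + 1, L, m, K, hd, hL⟩ : Params) →ₗ[ℝ] BondSpace (⟨d + 1, L, m, K, hd, hL⟩ : Params))) ∘ₗ (tsV1 hc Λ' w).Hj) ∘ₗ
        (tsV1 hc Λ' w).Ct ∘ₗ
          LinearMap.adjoint (((((L : ℝ) ^ j) • (onE (LinearMap.funLeft ℝ ℝ (fun b : PBond (⟨d + 1, L, m, K, hd, hL⟩ : Params) 0 => (⟨b.src.shift lam, b.dir⟩ : PBond (⟨d + 1, L, m, K, hd, hL⟩ : Params) 0))) - LinearMap.id) : BondSpace (⟨d + 1, L, m, K, hd, hL⟩ : Params) →ₗ[ℝ] BondSpace (⟨d + 1, L, m, K, hd, hL⟩ : Params))) ∘ₗ (tsV1 hc Λ' w).Hj) := by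
    rw [← hadj]
    refine LinearMap.ext fun v => ?_
    simp only [LinearMap.comp_apply]
  rw [hop]
  have h := holderBound_comp hρ hK (((((L : ℝ) ^ j) • (onE (LinearMap.funLeft ℝ ℝ (fun b : PBond (⟨d + 1, L, m, K, hd, hL⟩ : Params) 0 => (⟨b.src.shift mu, b.dir⟩ : PBond (⟨d + 1, L, m, K, hd, hL⟩ : Params) 0))) - LinearMap.id) : BondSpace (⟨d + 1, L, m, K, hd, hL⟩ : Params) →ₗ[ℝ] BondSpace (⟨d + 1, L, m, K, hd, hL⟩ : Params))) ∘ₗ (tsV1 hc Λ' w).Hj) ((tsV1 hc Λ' w).Ct ∘ₗ LinearMap.adjoint (((((L : ℝ) ^ j) • (onE (LinearMap.funLeft ℝ ℝ (fun b : PBond (⟨d + 1, L, m, K, hd, hL⟩ : Params) 0 => (⟨b.src.shift lam, b.dir⟩ : PBond (⟨d + 1, L, m, K, hd, hL⟩ : Params) 0))) - LinearMap.id) : BondSpace (⟨d + 1, L, m, K, hd, hL⟩ : Params) →ₗ[ℝ] BondSpace (⟨d + 1, L, m, K, hd, hL⟩ : Params))) ∘ₗ (tsV1 hc Λ' w).H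j))
    (fun b : PBond (⟨d + 1, L, m, K, hd, hL⟩ : Params) j => b.src) (fun b₀ : PBond (⟨d + 1, L, m, K, hd, hL⟩ : Params) 0 => iterBlockOf j b₀.src) b₁ b₂ (iterBlockOf j b₁.src)
    (by positivity : 0 ≤ CH * (((supDist b₁.src b₂.src : ℕ) : ℝ) / (L : ℝ) ^ j) ^ α)
    (by positivity : 0 ≤ E / n * (AH * (n * ((d + 1 : ℕ) : ℝ))) * K₁)
    hδ0.le hδδ₁ hδH' hf hg y
  refine h.trans (le_of_eq ?_)
  have hn' : E / n * (AH * (n * ((d + 1 : ℕ) : ℝ))) = E * (AH * ((d + 1 : ℕ) : ℝ)) := by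
    field_simp
  rw [hn', hC, hK₁, hK₂]
  ring

end Literature.MathematicalPhysics.QuantumFieldTheory.Balaban1983to89.B6Block113CompositesV1

end
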